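import Literature.MathematicalPhysics.QuantumFieldTheory.FiniteTemperaturePolyakovChessboard
import Literature.MathematicalPhysics.QuantumFieldTheory.FiniteTemperatureTemporalGauge
import Literature.MathematicalPhysics.QuantumFieldTheory.SU2TransferKernelBound
import HarnessLib

/-!
# Tomboulis–Yaffe's disorder bounds at zero space-like coupling (TY85 (3.18)–(3.26)): the pattern
# bounds `⟨∏_x (1 − |½tr Ω_x|)⟩ ≤ K(J)^{|Λ|}`, `⟨all bonds of one axis are walls⟩ ≤ K(J)^{d|Λ|}`, `K(J) → 0`

This file closes hypothesis `X''` of `FiniteTemperaturePolyakovChessboard.disorderBounds_of_electricPatternBounds`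
(the two full-lattice PATTERN bounds for the finite-temperature `SU(2)` theory with `J_M = 0`, uniformly in the
spatial box `L = 2^k ≥ 4`), hence Tomboulis–Yaffe's disorder bounds (3.5)–(3.6) and — through the tree's Peierls
reduction `SU2HighTemperaturePeierlsReduction` — Theorems I and II of [TomboulisYaffe1985] (the named facts
`PolyakovTwoPointLowerBound`, `MagneticFluxFreeEnergyBound` of `SU2HighTemperatureNonConfinement.lean`; their
`_holds` theorems are in `SU2HighTemperatureNonConfinementHolds.lean`).

The proof follows §III.C of the paper in the spin-model representation of `FiniteTemperatureTemporalGauge.lean`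
(`∫ F(Ω) e^{−S_{J,0}} = ∫_{SU(2)^{Λ}} F(Ω) ∏_{⟨y,y+e_i⟩} K_{L₀}(Ω_y, Ω_{y+e_i}) ∏dΩ`) with the kernel bounds of
`SU2TransferKernelBound.lean` (`κ C e^{b} ≤ K_{L₀} ≤ C · J(·,·; b)` near the identity resp. everywhere,
`2J/4^{L₀−1} ≤ b ≤ 2J`) and of `SU2PolyakovPairKernel.lean` ((3.17): `J(Ω,Ω';b) ≤ e^{b cos(ω−ω')}`,
`sin ω sin ω' J(Ω,Ω';b) ≤ e^{b cos(ω−ω')}/(2b)`):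

* the partition function from below: all twists in the polar cap of radius `J^{−1/2}` (cubic small-ball law);
* (3.18)–(3.19): `1 − |½trΩ| ≤ sin²ω`, and `sin ω sin ω' J ≤ e^{b}/(2b)` on the bonds of ONE axis, `J ≤ e^{b}/(2b ŝ ŝ')`
  (`ŝ = max(sin ω, 1/2b)`) on a SECOND axis, `J ≤ e^{b}` on the others — the site integral `∫ ŝ^{−2} dΩ ≤ 2` by Weyl's
  formula; no `XY`-model comparison is needed at this precision (the resulting rate is `K(J) ≍ J^{−1/2}`, TY's App. IV
  gives the sharp power);
* (3.20)–(3.24): on a wall bond `cos(ω − ω') ≤ sin ω sin ω' ≤ ½(sin²ω + sin²ω')`, so the sites DECOUPLE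
  ("`|Λ_s|` decoupled integrals"), with site integral `∫ e^{b sin²ω} ŝ^{−2d} dΩ ≤ 2^d e^{b} + 2(2b)^{2d−2} e^{b/2}`.
[cite: TomboulisYaffe1985, §III.C (3.16)–(3.26), pp. 324–325]
-/

open MeasureTheory Filter Topology Function
open scoped ENNReal
open Literature.MathematicalPhysics.QuantumLattice (fundamentalRep fundamentalRep_apply continuous_fundamentalRep
  fundamentalRep_mem_unitaryGroup)
open Literature.MathematicalPhysics.QuantumFieldTheory.SU2PairKernel
open Literature.Barriers.QuantumFields Literature.Barriers.QuantumFields.FiniteTemperature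

namespace Literature.MathematicalPhysics.QuantumFieldTheory.TomboulisYaffeHighTemperature

noncomputable section

/-! ### §1. Product integrals on the spin space `SU(2)^Λ` and torus book-keeping -/

section Tools

variable {Λ : Type*} [Fintype Λ] [DecidableEq Λ] {G : Type*} [MeasurableSpace G] [Nonempty G]
  (μ : Measure G) [IsProbabilityMeasure μ]

/-- **Independent sites integrate independently**: `∫ ∏_y h_y(Ω_y) ∏_y dμ(Ω_y) = ∏_y ∫ h_y dμ`.
[cite: Dudley2002, Thm 4.4.5 (Tonelli–Fubini), p. 137] -/
theorem lintegral_pi_finset_prod (h : Λ → G → ℝ≥0∞) (hm : ∀ y, Measurable (h y)) :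
    ∫⁻ Ω, ∏ y, h y (Ω y) ∂Measure.pi (fun _ : Λ => μ) = ∏ y, ∫⁻ g, h y g ∂μ := by
  classical
  set W₁ : Λ → G := fun _ => Classical.arbitrary G
  have h := lmarginal_biUnion_prod_eq_prod (μ := fun _ : Λ => μ) Finset.univ (fun y => ({y} : Finset Λ))
    (fun y => ({y} : Set Λ)) (fun y Ω => h y (Ω y)) (fun y => (hm y).comp (measurable_pi_apply y))
    (fun y => by intro U V hUV; simp only [hUV y rfl])
    (fun b _ b' _ hbb' i hi hT => by
      rw [Finset.mem_singleton] at hi; rw [Set.mem_singleton_iff] at hT; exact hbb' (hT.symm.trans hi))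
    (fun b _ b' _ hbb' => Finset.disjoint_singleton.mpr hbb')
  rw [Finset.biUnion_singleton_eq_self] at h
  rw [lintegral_eq_lmarginal_univ W₁, h]
  refine Finset.prod_congr rfl fun y _ => ?_
  rw [lmarginal_singleton]
  simp

omit [DecidableEq Λ] [Nonempty G] in
/-- On the periodic box every translate of a product over sites is the same product. [folklore] -/
private theorem prod_add_eq_prod {L d : ℕ} [NeZero L] (f : (Fin d → ZMod L) → ℝ≥0∞) (v : Fin d → ZMod L) :
    ∏ y : Fin d → ZMod L, f (y + v) = ∏ y, f y :=
  Fintype.prod_equiv (Equiv.addRight v) _ _ fun _ => rfl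

end Tools

/-! ### §2. Expectations at `J_M = 0` as ratios of spin-model integrals -/

section Spin

variable {d L₀ L : ℕ} [NeZero L₀] [NeZero L]

/-- The spin-model integral `S(F) = ∫ F(Ω) ∏_{⟨y,y+e_i⟩} K_{L₀}(Ω_y, Ω_{y+e_i}) ∏_y dΩ_y` (the right-hand side of the
transfer-matrix representation, `FiniteTemperatureTemporalGauge`). [cite: TomboulisYaffe1985, §III (3.11), p. 323] -/
def spinIntegral (L₀ : ℕ) [NeZero L₀] (J : ℝ) (F : ((Fin d → ZMod L) → SU2) → ℝ≥0∞) : ℝ≥0∞ :=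
  ∫⁻ Ω, F Ω * ∏ b : (Fin d → ZMod L) × Fin d,
      transferKernel (fundamentalRep (Fin 2)) L₀ J (Ω b.1) (Ω (b.1 + Pi.single b.2 1))
    ∂Measure.pi fun _ : Fin d → ZMod L => QuantumFieldTheory.haarProbability SU2

omit [NeZero L₀] [NeZero L] in
/-- `½ tr Ω[y] = ½Re tr` of the Polyakov line. [cite: TomboulisYaffe1985, §II.A (2.6), p. 316] -/
theorem halfTrace_eq_htr (U : Config d L₀ L SU2) (y : Fin d → ZMod L) : halfTrace U y = htr (polyakovLine U y) := rfl

/-- The Polyakov-line map is measurable. [folklore] -/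
private theorem measurable_polyakovLine :
    Measurable fun U : Config d L₀ L SU2 => polyakovLine U :=
  measurable_pi_lambda _ fun _ => (continuous_timeHolonomy _ _).measurable

/-- **Expectations at zero space-like coupling are ratios of spin-model integrals**: for a measurable
`G ≥ 0` of the Polyakov lines, `⟨G(Ω)⟩_{J,0} = S(G)/S(1)`. [cite: TomboulisYaffe1985, §III (3.11), p. 323] -/
theorem expectation_eq_spinIntegral_div (J : ℝ) (G : ((Fin d → ZMod L) → SU2) → ℝ) (hGm : Measurable G)
    (hG0 : ∀ Ω, 0 ≤ G Ω) :
    expectation (fundamentalRep (Fin 2)) J 0 (fun U : Config d L₀ L SU2 => G (polyakovLine U)) =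
      (spinIntegral L₀ J (fun Ω => ENNReal.ofReal (G Ω))).toReal /
        (spinIntegral (d := d) (L := L) L₀ J (fun _ => 1)).toReal := by
  have hρ := continuous_fundamentalRep (Fin 2)
  have hw := continuous_weight (d := d) (L₀ := L₀) (L := L) (fundamentalRep (Fin 2)) hρ J 0
  unfold expectation
  congr 1
  · rw [integral_eq_lintegral_of_nonneg_ae (Eventually.of_forall fun U => mul_nonneg (hG0 _) (weight_pos _ _ _ _).le)
      (((hGm.comp measurable_polyakovLine).mul hw.measurable).aestronglyMeasurable)]
    congr 1
    rw [spinIntegral, ← lintegral_polyakov_mul_weight_eq_lintegral_transferKernel (fundamentalRep (Fin 2)) hρ J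
      (fun Ω => ENNReal.ofReal (G Ω)) (ENNReal.measurable_ofReal.comp hGm)]
    refine lintegral_congr fun U => ?_
    rw [ENNReal.ofReal_mul (hG0 _)]
  · rw [integral_eq_lintegral_of_nonneg_ae (Eventually.of_forall fun U => (weight_pos _ _ _ _).le)
      hw.measurable.aestronglyMeasurable]
    congr 1
    rw [spinIntegral, ← lintegral_polyakov_mul_weight_eq_lintegral_transferKernel (fundamentalRep (Fin 2)) hρ J
      (fun _ => 1) measurable_const]
    simp

/-- `S(1) < ∞` (it is the partition function). [cite: TomboulisYaffe1985, §III (3.11), p. 323] -/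
theorem spinIntegral_one_lt_top (J : ℝ) : spinIntegral (d := d) (L := L) L₀ J (fun _ => 1) < ∞ := by
  have hρ := continuous_fundamentalRep (Fin 2)
  rw [spinIntegral, ← lintegral_polyakov_mul_weight_eq_lintegral_transferKernel (fundamentalRep (Fin 2)) hρ J
    (fun _ => 1) measurable_const]
  simp only [one_mul]
  exact (integrable_of_continuous (continuous_weight (fundamentalRep (Fin 2)) hρ J 0)).lintegral_lt_top

/-- **Ratio bound**: if `S(G) ≤ A` and `S(1) ≥ B > 0` then `⟨G(Ω)⟩_{J,0} ≤ A/B`. [cite: TomboulisYaffe1985, §III (3.9)–(3.11), p. 323] -/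
theorem expectation_le_div (J : ℝ) (G : ((Fin d → ZMod L) → SU2) → ℝ) (hGm : Measurable G)
    (hG0 : ∀ Ω, 0 ≤ G Ω) {A B : ℝ} (hA : 0 ≤ A) (hB : 0 < B)
    (hnum : spinIntegral L₀ J (fun Ω => ENNReal.ofReal (G Ω)) ≤ ENNReal.ofReal A)
    (hden : ENNReal.ofReal B ≤ spinIntegral (d := d) (L := L) L₀ J (fun _ => 1)) :
    expectation (fundamentalRep (Fin 2)) J 0 (fun U : Config d L₀ L SU2 => G (polyakovLine U)) ≤ A / B := by
  rw [expectation_eq_spinIntegral_div J G hGm hG0]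
  exact div_le_div₀ hA (ENNReal.toReal_le_of_le_ofReal hA hnum) hB
    ((ENNReal.ofReal_le_iff_le_toReal (spinIntegral_one_lt_top J).ne).mp hden)

end Spin

/-! ### §3. The partition function from below: all twists in the polar cap -/

section Lower

variable {d L : ℕ} [NeZero L] {n : ℕ}

/-- The coincidence scale `κ_n C_n(J) e^{b_n(J)}` of the transfer kernel `K_{n+1}`. [cite: TomboulisYaffe1985, §III (3.15), p. 324] -/
def kernelScale (n : ℕ) (J : ℝ) : ℝ := kernelRatioConst n * (cSeq J n * Real.exp (bSeq J n))

/-- `kernelScale n J > 0`. [cite: TomboulisYaffe1985, §III (3.15), p. 324] -/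
theorem kernelScale_pos (n : ℕ) (J : ℝ) : 0 < kernelScale n J :=
  mul_pos (kernelRatioConst_pos n) (mul_pos (cSeq_pos J n) (Real.exp_pos _))

/-- **Lower bound on the partition function**: `Z = S(1) ≥ [μ(cap_{J^{−1/2}}) · (κ_n C_n e^{b_n})^d]^{|Λ|}`
(restrict every twist to the polar cap of radius `J^{−1/2}` and use the two-sided kernel bound at coincidence).
[cite: TomboulisYaffe1985, §III (3.15)–(3.18) and App. III.B, pp. 324, 338] -/
theorem pow_le_spinIntegral_one {J : ℝ} (hJ : 1 ≤ J) :
    ENNReal.ofReal ((QuantumFieldTheory.haarProbability SU2).real (polarCap (Real.sqrt J)⁻¹) *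
        kernelScale n J ^ d) ^ Fintype.card (Fin d → ZMod L) ≤
      spinIntegral (d := d) (L := L) (n + 1) J (fun _ => 1) := by
  classical
  set cap := polarCap (Real.sqrt J)⁻¹ with hcap
  set s₀ : ℝ≥0∞ := ENNReal.ofReal (kernelScale n J) with hs₀
  -- pointwise: indicator of the product cap times the constant
  have hpt : ∀ Ω : (Fin d → ZMod L) → SU2,
      (∏ y, cap.indicator (1 : SU2 → ℝ≥0∞) (Ω y)) * s₀ ^ Fintype.card ((Fin d → ZMod L) × Fin d) ≤
        1 * ∏ b : (Fin d → ZMod L) × Fin d,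
          transferKernel (fundamentalRep (Fin 2)) (n + 1) J (Ω b.1) (Ω (b.1 + Pi.single b.2 1)) := by
    intro Ω
    rw [one_mul]
    by_cases hΩ : ∀ y, Ω y ∈ cap
    · have h1 : ∏ y, cap.indicator (1 : SU2 → ℝ≥0∞) (Ω y) = 1 :=
        Finset.prod_eq_one fun y _ => by simp [Set.indicator_of_mem (hΩ y)]
      rw [h1, one_mul, ← Finset.card_univ, ← Finset.prod_const]
      exact Finset.prod_le_prod' fun b _ =>
        kernelScale_le_transferKernel J (Ω b.1) (Ω (b.1 + Pi.single b.2 1)) hJ (hΩ _) (hΩ _)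
    · push Not at hΩ
      obtain ⟨y, hy⟩ := hΩ
      have h0 : ∏ y, cap.indicator (1 : SU2 → ℝ≥0∞) (Ω y) = 0 :=
        Finset.prod_eq_zero (Finset.mem_univ y) (by simp [Set.indicator_of_notMem hy])
      rw [h0, zero_mul]
      exact bot_le
  have hmeas : MeasurableSet cap := by
    have h : Continuous (htr : SU2 → ℝ) := (Complex.continuous_re.comp (continuous_subtype_val.matrix_trace)).div_const _
    exact measurableSet_le (Real.continuous_arccos.comp h).measurable measurable_const
  calc ENNReal.ofReal ((QuantumFieldTheory.haarProbability SU2).real cap * kernelScale n J ^ d) ^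
        Fintype.card (Fin d → ZMod L)
      = (∏ _y : Fin d → ZMod L, (QuantumFieldTheory.haarProbability SU2) cap) *
          s₀ ^ Fintype.card ((Fin d → ZMod L) × Fin d) := by
        rw [Finset.prod_const, Finset.card_univ, Fintype.card_prod, Fintype.card_fin, pow_mul', ← mul_pow,
          ENNReal.ofReal_mul measureReal_nonneg, ofReal_measureReal, ENNReal.ofReal_pow (kernelScale_pos n J).le]
    _ = (∫⁻ Ω, ∏ y, cap.indicator (1 : SU2 → ℝ≥0∞) (Ω y) ∂Measure.pi fun _ : Fin d → ZMod L =>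
          QuantumFieldTheory.haarProbability SU2) * s₀ ^ Fintype.card ((Fin d → ZMod L) × Fin d) := by
        rw [lintegral_pi_finset_prod _ (fun _ => cap.indicator 1) (fun _ => measurable_one.indicator hmeas),
          lintegral_indicator_one hmeas]
    _ = ∫⁻ Ω, (∏ y, cap.indicator (1 : SU2 → ℝ≥0∞) (Ω y)) * s₀ ^ Fintype.card ((Fin d → ZMod L) × Fin d)
          ∂Measure.pi fun _ : Fin d → ZMod L => QuantumFieldTheory.haarProbability SU2 := by
        have hm' : Measurable (fun Ω : (Fin d → ZMod L) → SU2 => ∏ y, cap.indicator (1 : SU2 → ℝ≥0∞) (Ω y)) :=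
          Finset.measurable_prod _ fun y _ => (measurable_one.indicator hmeas).comp (measurable_pi_apply y)
        rw [lintegral_mul_const _ hm']
    _ ≤ spinIntegral (n + 1) J (fun _ => 1) := lintegral_mono hpt

end Lower

/-! ### §4. Pointwise bounds on the pair kernel (TY (3.17) and the wall inequality) -/

section PairBounds

/-- The regularised sine `ŝ = max(sin ω, 1/2b)`. [cite: TomboulisYaffe1985, §III.C (3.17)–(3.20), p. 324] -/
def sHat (b : ℝ) (g : SU2) : ℝ := max (Real.sin (classAngle g)) (1 / (2 * b))

/-- `ŝ > 0` for `b > 0`. [cite: TomboulisYaffe1985, §III.C (3.17), p. 324] -/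
theorem sHat_pos {b : ℝ} (hb : 0 < b) (g : SU2) : 0 < sHat b g :=
  lt_max_of_lt_right (by positivity)

/-- `ŝ ≥ sin ω`. [cite: TomboulisYaffe1985, §III.C (3.17), p. 324] -/
theorem sin_le_sHat (b : ℝ) (g : SU2) : Real.sin (classAngle g) ≤ sHat b g := le_max_left _ _

/-- `ŝ ≥ 1/2b`. [cite: TomboulisYaffe1985, §III.C (3.17), p. 324] -/
theorem inv_le_sHat (b : ℝ) (g : SU2) : 1 / (2 * b) ≤ sHat b g := le_max_right _ _

/-- `ŝ ≤ 1` for `b ≥ 1/2`. [cite: TomboulisYaffe1985, §III.C (3.17), p. 324] -/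
theorem sHat_le_one {b : ℝ} (hb : 1 / 2 ≤ b) (g : SU2) : sHat b g ≤ 1 := by
  refine max_le (Real.sin_le_one _) ?_
  rw [div_le_one (by linarith)]; linarith

/-- **The regularised form of (3.17)**: `J(Ω,Ω';b) ≤ e^{b cos(ω−ω')}/(2b ŝ ŝ')` for `b ≥ 1/2` (from the tree's
`pairKernel_le_exp` and `sin_mul_sin_mul_pairKernel_le`). [cite: TomboulisYaffe1985, §III.C (3.17), p. 324] -/
theorem pairKernel_le_exp_div_sHat {b : ℝ} (hb : 1 / 2 ≤ b) (g g' : SU2) :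
    pairKernel b g g' ≤ Real.exp (b * Real.cos (classAngle g - classAngle g')) / (2 * b * sHat b g * sHat b g') := by
  have hb0 : 0 < b := by linarith
  set E := Real.exp (b * Real.cos (classAngle g - classAngle g')) with hE
  have hE0 : 0 < E := Real.exp_pos _
  have h1 : pairKernel b g g' ≤ E := pairKernel_le_exp b hb0.le g g'
  have h2 : Real.sin (classAngle g) * Real.sin (classAngle g') * pairKernel b g g' ≤ E / (2 * b) :=
    sin_mul_sin_mul_pairKernel_le b hb0 g g'
  have hs := sHat_pos hb0 g
  have hs' := sHat_pos hb0 g'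
  have hP := (pairKernel_pos b g g').le
  rw [le_div_iff₀ (by positivity)]
  by_cases hg : Real.sin (classAngle g) < 1 / (2 * b)
  · -- `ŝ = 1/2b`, so `2b ŝ ŝ' = ŝ' ≤ 1`
    have hsg : sHat b g = 1 / (2 * b) := max_eq_right hg.le
    rw [hsg]
    calc pairKernel b g g' * (2 * b * (1 / (2 * b)) * sHat b g') = pairKernel b g g' * sHat b g' := by
          field_simp
      _ ≤ E * 1 := mul_le_mul h1 (sHat_le_one hb g') hs'.le hE0.le
      _ = E := mul_one E
  · by_cases hg' : Real.sin (classAngle g') < 1 / (2 * b)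
    · have hsg' : sHat b g' = 1 / (2 * b) := max_eq_right hg'.le
      rw [hsg']
      calc pairKernel b g g' * (2 * b * sHat b g * (1 / (2 * b))) = pairKernel b g g' * sHat b g := by
            field_simp
        _ ≤ E * 1 := mul_le_mul h1 (sHat_le_one hb g) hs.le hE0.le
        _ = E := mul_one E
    · -- both sines are `≥ 1/2b`: `ŝ = sin`
      push Not at hg hg'
      have hsg : sHat b g = Real.sin (classAngle g) := max_eq_left hg
      have hsg' : sHat b g' = Real.sin (classAngle g') := max_eq_left hg'
      rw [hsg, hsg']
      rw [le_div_iff₀ (by positivity)] at h2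
      linarith

/-- `sin ω sin ω' J(Ω,Ω';b) ≤ e^{b}/(2b)` (`b > 0`). [cite: TomboulisYaffe1985, §III.C (3.17), p. 324] -/
theorem sin_mul_sin_mul_pairKernel_le_exp {b : ℝ} (hb : 0 < b) (g g' : SU2) :
    Real.sin (classAngle g) * Real.sin (classAngle g') * pairKernel b g g' ≤ Real.exp b / (2 * b) := by
  refine (sin_mul_sin_mul_pairKernel_le b hb g g').trans (div_le_div_of_nonneg_right ?_ (by positivity))
  refine Real.exp_le_exp.mpr ?_
  nlinarith [Real.cos_le_one (classAngle g - classAngle g')]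

/-- `J(Ω,Ω';b) ≤ e^{b}/(2b ŝ ŝ')` (`b ≥ 1/2`). [cite: TomboulisYaffe1985, §III.C (3.17), p. 324] -/
theorem pairKernel_le_exp_div_sHat' {b : ℝ} (hb : 1 / 2 ≤ b) (g g' : SU2) :
    pairKernel b g g' ≤ Real.exp b / (2 * b * sHat b g * sHat b g') := by
  have hb0 : 0 < b := by linarith
  refine (pairKernel_le_exp_div_sHat hb g g').trans (div_le_div_of_nonneg_right ?_ ?_)
  · refine Real.exp_le_exp.mpr ?_
    nlinarith [Real.cos_le_one (classAngle g - classAngle g')]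
  · have := sHat_pos hb0 g; have := sHat_pos hb0 g'; positivity

/-- **The wall inequality**: if the two twists lie in opposite hemispheres (`½trΩ · ½trΩ' ≤ 0`) then
`cos(ω − ω') ≤ ½(sin²ω + sin²ω')`. [cite: TomboulisYaffe1985, §III.C (3.20), p. 324] -/
theorem cos_sub_le_of_wall {g g' : SU2} (h : ¬ (0 ≤ htr g ↔ 0 ≤ htr g')) :
    Real.cos (classAngle g - classAngle g') ≤ (Real.sin (classAngle g) ^ 2 + Real.sin (classAngle g') ^ 2) / 2 := by
  rw [Real.cos_sub, cos_classAngle, cos_classAngle]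
  have hprod : htr g * htr g' ≤ 0 := by
    unfold htr at h ⊢
    by_cases h0 : 0 ≤ ((g : Matrix (Fin 2) (Fin 2) ℂ).trace.re) / 2
    · have h1 : ¬ 0 ≤ ((g' : Matrix (Fin 2) (Fin 2) ℂ).trace.re) / 2 := fun h1 => h ⟨fun _ => h1, fun _ => h0⟩
      push Not at h1
      exact mul_nonpos_of_nonneg_of_nonpos h0 h1.le
    · push Not at h0
      have h1 : 0 ≤ ((g' : Matrix (Fin 2) (Fin 2) ℂ).trace.re) / 2 := by
        by_contra h1; push Not at h1
        exact h ⟨fun h2 => absurd h2 (not_le.mpr h0), fun h2 => absurd h2 (not_le.mpr h1)⟩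
      exact mul_nonpos_of_nonpos_of_nonneg h0.le h1
  unfold htr at hprod
  nlinarith [sq_nonneg (Real.sin (classAngle g) - Real.sin (classAngle g'))]

/-- **The wall bound on the pair kernel**: on a wall bond,
`J(Ω,Ω';b) ≤ e^{b sin²ω/2} e^{b sin²ω'/2}/(2b ŝ ŝ')` (`b ≥ 1/2`). [cite: TomboulisYaffe1985, §III.C (3.20), p. 324] -/
theorem pairKernel_le_of_wall {b : ℝ} (hb : 1 / 2 ≤ b) {g g' : SU2} (h : ¬ (0 ≤ htr g ↔ 0 ≤ htr g')) :
    pairKernel b g g' ≤ Real.exp (b * Real.sin (classAngle g) ^ 2 / 2) * Real.exp (b * Real.sin (classAngle g') ^ 2 / 2) /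
      (2 * b * sHat b g * sHat b g') := by
  have hb0 : 0 < b := by linarith
  refine (pairKernel_le_exp_div_sHat hb g g').trans (div_le_div_of_nonneg_right ?_ ?_)
  · rw [← Real.exp_add]
    refine Real.exp_le_exp.mpr ?_
    have := cos_sub_le_of_wall h
    nlinarith
  · have := sHat_pos hb0 g; have := sHat_pos hb0 g'; positivity

end PairBounds

/-! ### §5. The two site integrals (Weyl's integration formula) -/

section SiteIntegrals

/-- `ŝ` as a function of the trace: `ŝ(Ω) = max(√(1 − (½Re tr Ω)²), 1/2b)`. [cite: TomboulisYaffe1985, §III.C (3.17), p. 324] -/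
theorem sHat_eq_trace (b : ℝ) (g : SU2) :
    sHat b g = max (Real.sqrt (1 - (((g : Matrix (Fin 2) (Fin 2) ℂ).trace.re) / 2) ^ 2)) (1 / (2 * b)) := by
  rw [sHat, classAngle_eq_arccos_htr, Real.sin_arccos, htr]

/-- `sin² ω = 1 − (½Re tr)²`. [cite: TomboulisYaffe1985, §III.C (3.18), p. 324] -/
theorem sin_classAngle_sq_eq_trace (g : SU2) :
    Real.sin (classAngle g) ^ 2 = 1 - (((g : Matrix (Fin 2) (Fin 2) ℂ).trace.re) / 2) ^ 2 := by
  have h := htr_mem_Icc g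
  rw [classAngle_eq_arccos_htr, Real.sin_arccos, Real.sq_sqrt (by nlinarith [h.1, h.2])]
  rfl

/-- The trace profile of `ŝ⁻²`: `x ↦ max(√(1 − x²/4), 1/2b)⁻²`, continuous for `b > 0`. [folklore] -/
private theorem continuous_sHatProfile {b : ℝ} (hb : 0 < b) (k : ℕ) :
    Continuous fun x : ℝ => ((max (Real.sqrt (1 - (x / 2) ^ 2)) (1 / (2 * b)))⁻¹) ^ k := by
  refine Continuous.pow (Continuous.inv₀ (by fun_prop) fun x => ?_) k
  exact (lt_max_of_lt_right (by positivity)).ne'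

/-- On the class angle: `max(√(1 − cos²θ), c) = max(|sin θ|, c)`. [folklore] -/
private theorem max_sqrt_eq (θ c : ℝ) : max (Real.sqrt (1 - (2 * Real.cos θ / 2) ^ 2)) c = max (|Real.sin θ|) c := by
  rw [mul_div_cancel_left₀ _ (two_ne_zero), ← Real.abs_sin_eq_sqrt_one_sub_cos_sq]

/-- **First site integral**: `∫_{SU(2)} ŝ(Ω)⁻² dΩ ≤ 2` (Weyl: the density `sin²ω` cancels the pole of `ŝ⁻²`).
[cite: TomboulisYaffe1985, §III.C (3.18)–(3.19), p. 324] -/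
theorem integral_sHat_inv_sq_le {b : ℝ} (hb : 0 < b) :
    ∫ g, (sHat b g)⁻¹ ^ 2 ∂QuantumFieldTheory.haarProbability SU2 ≤ 2 := by
  have hπ := Real.pi_pos
  set φ : ℝ → ℝ := fun x => ((max (Real.sqrt (1 - (x / 2) ^ 2)) (1 / (2 * b)))⁻¹) ^ 2 with hφ
  have hφc : Continuous φ := continuous_sHatProfile hb 2
  have h1 : ∫ g, (sHat b g)⁻¹ ^ 2 ∂QuantumFieldTheory.haarProbability SU2 =
      ∫ g, φ (((g : Matrix (Fin 2) (Fin 2) ℂ).trace.re)) ∂QuantumFieldTheory.haarProbability SU2 := by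
    refine integral_congr_ae (Eventually.of_forall fun g => ?_)
    simp only [hφ, sHat_eq_trace]
  rw [h1, SU2OneLink.integral_trace_fun_haarProbability_su2 φ hφc.measurable]
  -- the angular integrand is `sin²θ / max(|sin θ|, c)² ≤ 1`
  have hpt : ∀ θ : ℝ, φ (2 * Real.cos θ) * Real.sin θ ^ 2 ≤ 1 := by
    intro θ
    simp only [hφ]
    rw [max_sqrt_eq]
    have hm : |Real.sin θ| ≤ max (|Real.sin θ|) (1 / (2 * b)) := le_max_left _ _
    have hm0 : 0 < max (|Real.sin θ|) (1 / (2 * b)) := lt_max_of_lt_right (by positivity)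
    have key : (max (|Real.sin θ|) (1 / (2 * b)))⁻¹ ^ 2 * Real.sin θ ^ 2 =
        (|Real.sin θ| * (max (|Real.sin θ|) (1 / (2 * b)))⁻¹) ^ 2 := by
      rw [mul_pow, sq_abs]; ring
    rw [key]
    refine pow_le_one₀ (by positivity) ?_
    rw [mul_inv_le_iff₀ hm0, one_mul]
    exact hm
  have hint : IntervalIntegrable (fun θ => φ (2 * Real.cos θ) * Real.sin θ ^ 2) volume 0 Real.pi :=
    ((hφc.comp (continuous_const.mul Real.continuous_cos)).mul (Real.continuous_sin.pow 2)).intervalIntegrable _ _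
  have h2 : ∫ θ in (0 : ℝ)..Real.pi, φ (2 * Real.cos θ) * Real.sin θ ^ 2 ≤ ∫ _θ in (0 : ℝ)..Real.pi, (1 : ℝ) :=
    intervalIntegral.integral_mono_on hπ.le hint intervalIntegrable_const fun θ _ => hpt θ
  rw [intervalIntegral.integral_const, sub_zero, smul_eq_mul, mul_one] at h2
  calc 2 / Real.pi * ∫ θ in (0 : ℝ)..Real.pi, φ (2 * Real.cos θ) * Real.sin θ ^ 2 ≤ 2 / Real.pi * Real.pi :=
        mul_le_mul_of_nonneg_left h2 (by positivity)
    _ = 2 := by field_simp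

/-- **Second site integral**: `∫_{SU(2)} e^{b sin²ω} ŝ(Ω)^{−(2m+2)} dΩ ≤ 2(2^m e^{b} + (2b)^{2m} e^{b/2})` for `b ≥ 1/2`
(split at `sin²ω = ½`: near the equator `ŝ ≥ 1/√2`, away from it `e^{b sin²ω} ≤ e^{b/2}` and `ŝ ≥ 1/2b`).
[cite: TomboulisYaffe1985, §III.C (3.20)–(3.24), pp. 324–325] -/
theorem integral_exp_mul_sHat_inv_pow_le {b : ℝ} (hb : 1 / 2 ≤ b) (m : ℕ) :
    ∫ g, Real.exp (b * Real.sin (classAngle g) ^ 2) * (sHat b g)⁻¹ ^ (2 * m + 2) ∂QuantumFieldTheory.haarProbability SU2 ≤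
      2 * (2 ^ m * Real.exp b + (2 * b) ^ (2 * m) * Real.exp (b / 2)) := by
  have hπ := Real.pi_pos
  have hb0 : 0 < b := by linarith
  set φ : ℝ → ℝ := fun x => Real.exp (b * (1 - (x / 2) ^ 2)) *
    ((max (Real.sqrt (1 - (x / 2) ^ 2)) (1 / (2 * b)))⁻¹) ^ (2 * m + 2) with hφ
  have hφc : Continuous φ := (Real.continuous_exp.comp (by fun_prop)).mul (continuous_sHatProfile hb0 _)
  have h1 : ∫ g, Real.exp (b * Real.sin (classAngle g) ^ 2) * (sHat b g)⁻¹ ^ (2 * m + 2)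
      ∂QuantumFieldTheory.haarProbability SU2 =
      ∫ g, φ (((g : Matrix (Fin 2) (Fin 2) ℂ).trace.re)) ∂QuantumFieldTheory.haarProbability SU2 := by
    refine integral_congr_ae (Eventually.of_forall fun g => ?_)
    simp only [hφ, sHat_eq_trace, sin_classAngle_sq_eq_trace]
  rw [h1, SU2OneLink.integral_trace_fun_haarProbability_su2 φ hφc.measurable]
  set M : ℝ := 2 ^ m * Real.exp b + (2 * b) ^ (2 * m) * Real.exp (b / 2) with hM
  -- pointwise bound of the angular integrand
  have hpt : ∀ θ : ℝ, φ (2 * Real.cos θ) * Real.sin θ ^ 2 ≤ M := by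
    intro θ
    simp only [hφ]
    rw [max_sqrt_eq, mul_div_cancel_left₀ _ (two_ne_zero)]
    set t := |Real.sin θ| with ht
    set mx := max t (1 / (2 * b)) with hmx
    have ht0 : 0 ≤ t := abs_nonneg _
    have ht1 : t ≤ 1 := Real.abs_sin_le_one θ
    have hmx0 : 0 < mx := lt_max_of_lt_right (by positivity)
    have htm : t ≤ mx := le_max_left _ _
    have hcm : 1 / (2 * b) ≤ mx := le_max_right _ _
    have hsin2 : Real.sin θ ^ 2 = t ^ 2 := (sq_abs _).symm
    have hcos2 : 1 - Real.cos θ ^ 2 = t ^ 2 := by rw [← hsin2, Real.sin_sq]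
    rw [hcos2, hsin2]
    -- `t² mx⁻^(2m+2) = (t/mx)² (mx⁻¹)^(2m) ≤ (mx⁻¹)^(2m)`
    have hsplit : (mx⁻¹) ^ (2 * m + 2) * t ^ 2 = (t * mx⁻¹) ^ 2 * (mx⁻¹ ^ 2) ^ m := by ring
    have hratio : (t * mx⁻¹) ^ 2 ≤ 1 := by
      rw [pow_le_one_iff_of_nonneg (mul_nonneg ht0 (inv_pos.mpr hmx0).le) two_ne_zero, mul_inv_le_iff₀ hmx0, one_mul]
      exact htm
    have hA : Real.exp (b * t ^ 2) * (mx⁻¹ ^ (2 * m + 2) * t ^ 2) ≤ Real.exp (b * t ^ 2) * (mx⁻¹ ^ 2) ^ m := by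
      rw [hsplit]
      refine mul_le_mul_of_nonneg_left ?_ (Real.exp_pos _).le
      exact mul_le_of_le_one_left (by positivity) hratio
    rw [mul_assoc]
    refine hA.trans ?_
    by_cases hcase : 1 / 2 ≤ t ^ 2
    · -- equator: `mx ≥ t ≥ 1/√2`, `mx⁻² ≤ 2`, `e^{bt²} ≤ e^b`
      have h2 : mx⁻¹ ^ 2 ≤ 2 := by
        rw [inv_pow, inv_le_comm₀ (pow_pos hmx0 2) two_pos]
        nlinarith [pow_le_pow_left₀ ht0 htm 2]
      have h3 : Real.exp (b * t ^ 2) ≤ Real.exp b := Real.exp_le_exp.mpr (by nlinarith)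
      calc Real.exp (b * t ^ 2) * (mx⁻¹ ^ 2) ^ m ≤ Real.exp b * 2 ^ m :=
            mul_le_mul h3 (pow_le_pow_left₀ (by positivity) h2 m) (by positivity) (Real.exp_pos _).le
        _ ≤ M := by rw [hM]; nlinarith [Real.exp_pos (b / 2), pow_nonneg (by positivity : (0:ℝ) ≤ 2 * b) (2 * m)]
    · -- poles: `e^{bt²} ≤ e^{b/2}`, `mx⁻¹ ≤ 2b`
      push Not at hcase
      have h2 : mx⁻¹ ^ 2 ≤ (2 * b) ^ 2 := by
        refine pow_le_pow_left₀ (inv_pos.mpr hmx0).le ?_ 2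
        rw [inv_le_comm₀ hmx0 (by positivity)]
        refine le_trans (le_of_eq ?_) hcm
        rw [one_div]
      have h3 : Real.exp (b * t ^ 2) ≤ Real.exp (b / 2) := Real.exp_le_exp.mpr (by nlinarith)
      calc Real.exp (b * t ^ 2) * (mx⁻¹ ^ 2) ^ m ≤ Real.exp (b / 2) * ((2 * b) ^ 2) ^ m :=
            mul_le_mul h3 (pow_le_pow_left₀ (by positivity) h2 m) (by positivity) (Real.exp_pos _).le
        _ ≤ M := by rw [hM, ← pow_mul, mul_comm]; nlinarith [Real.exp_pos b, pow_nonneg (show (0:ℝ) ≤ 2 by norm_num) m]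
  have hint : IntervalIntegrable (fun θ => φ (2 * Real.cos θ) * Real.sin θ ^ 2) volume 0 Real.pi :=
    ((hφc.comp (continuous_const.mul Real.continuous_cos)).mul (Real.continuous_sin.pow 2)).intervalIntegrable _ _
  have h2 : ∫ θ in (0 : ℝ)..Real.pi, φ (2 * Real.cos θ) * Real.sin θ ^ 2 ≤ ∫ _θ in (0 : ℝ)..Real.pi, M :=
    intervalIntegral.integral_mono_on hπ.le hint intervalIntegrable_const fun θ _ => hpt θ
  rw [intervalIntegral.integral_const, sub_zero, smul_eq_mul] at h2
  have hM0 : 0 ≤ M := by rw [hM]; positivity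
  calc 2 / Real.pi * ∫ θ in (0 : ℝ)..Real.pi, φ (2 * Real.cos θ) * Real.sin θ ^ 2 ≤ 2 / Real.pi * (Real.pi * M) :=
        mul_le_mul_of_nonneg_left h2 (by positivity)
    _ = 2 * M := by field_simp

end SiteIntegrals

/-! ### §6. The point-defect pattern (TY (3.18)–(3.19)): `S(∏_x (1 − |½trΩ_x|)) ≤ [2 C^d (e^b/2b)² e^{b(d−2)}]^{|Λ|}` -/

section PointDefect

variable {m L L₀ : ℕ} [NeZero L] [NeZero L₀]

/-- `1 − |cos ω| ≤ sin² ω`. [cite: TomboulisYaffe1985, §III.C (3.18), p. 324] -/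
theorem one_sub_abs_htr_le_sin_sq (g : SU2) : 1 - |htr g| ≤ Real.sin (classAngle g) ^ 2 := by
  rw [Real.sin_sq, cos_classAngle]
  have h := htr_mem_Icc g
  have h1 : |htr g| ≤ 1 := abs_le.mpr ⟨h.1, h.2⟩
  unfold htr at h1 ⊢
  nlinarith [abs_nonneg (((g : Matrix (Fin 2) (Fin 2) ℂ).trace.re) / 2), sq_abs (((g : Matrix (Fin 2) (Fin 2) ℂ).trace.re) / 2)]

/-- **Pointwise bound for the point-defect pattern** (d = m+2 ≥ 2): with `P = pairKernel b`, `b ≥ 1/2`,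
`∏_x sin²ω_x · ∏_{⟨y,i⟩} C·P(Ω_y,Ω_{y+e_i}) ≤ [C^{m+2} (e^b/2b)² (e^b)^m]^{|Λ|} · ∏_y ŝ_y⁻²`
(axis `0`: `sin ω sin ω' P ≤ e^b/2b`; axis `1`: `P ≤ e^b/(2bŝŝ')`; other axes: `P ≤ e^b`).
[cite: TomboulisYaffe1985, §III.C (3.18)–(3.19), p. 324] -/
theorem pointDefect_pointwise {b C : ℝ} (hb : 1 / 2 ≤ b) (hC : 0 ≤ C) (Ω : (Fin (m + 2) → ZMod L) → SU2) :
    (∏ x, ENNReal.ofReal (Real.sin (classAngle (Ω x)) ^ 2)) *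
        ∏ bd : (Fin (m + 2) → ZMod L) × Fin (m + 2), ENNReal.ofReal (C * pairKernel b (Ω bd.1) (Ω (bd.1 + Pi.single bd.2 1))) ≤
      ENNReal.ofReal (C ^ (m + 2) * (Real.exp b / (2 * b)) ^ 2 * Real.exp b ^ m) ^ Fintype.card (Fin (m + 2) → ZMod L) *
        ∏ y, ENNReal.ofReal ((sHat b (Ω y))⁻¹ ^ 2) := by
  have hb0 : 0 < b := by linarith
  have hs0 : ∀ y, 0 ≤ Real.sin (classAngle (Ω y)) := fun y => sin_classAngle_nonneg _
  -- split off the constants `C` and sort the bonds by direction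
  have hsplitC : ∏ bd : (Fin (m + 2) → ZMod L) × Fin (m + 2),
      ENNReal.ofReal (C * pairKernel b (Ω bd.1) (Ω (bd.1 + Pi.single bd.2 1))) =
      ENNReal.ofReal C ^ (Fintype.card (Fin (m + 2) → ZMod L) * (m + 2)) *
        ∏ i : Fin (m + 2), ∏ y, ENNReal.ofReal (pairKernel b (Ω y) (Ω (y + Pi.single i 1))) := by
    simp_rw [ENNReal.ofReal_mul hC]
    rw [Finset.prod_mul_distrib, Finset.prod_const, Finset.card_univ, Fintype.card_prod, Fintype.card_fin,
      Fintype.prod_prod_type, Finset.prod_comm]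
  rw [hsplitC, Fin.prod_univ_succ, Fin.prod_univ_succ]
  simp only [Fin.succ_zero_eq_one]
  -- axis 0 with the sines
  have h0 : (∏ x, ENNReal.ofReal (Real.sin (classAngle (Ω x)) ^ 2)) *
      ∏ y, ENNReal.ofReal (pairKernel b (Ω y) (Ω (y + Pi.single 0 1))) ≤
      ENNReal.ofReal (Real.exp b / (2 * b)) ^ Fintype.card (Fin (m + 2) → ZMod L) := by
    have hre : ∏ x, ENNReal.ofReal (Real.sin (classAngle (Ω x)) ^ 2) =
        ∏ y, ENNReal.ofReal (Real.sin (classAngle (Ω y))) * ENNReal.ofReal (Real.sin (classAngle (Ω (y + Pi.single 0 1)))) := by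
      rw [Finset.prod_mul_distrib, prod_add_eq_prod (fun y => ENNReal.ofReal (Real.sin (classAngle (Ω y)))),
        ← Finset.prod_mul_distrib]
      refine Finset.prod_congr rfl fun y _ => ?_
      rw [← ENNReal.ofReal_mul (hs0 y), sq]
    rw [hre, ← Finset.prod_mul_distrib, ← Finset.card_univ, ← Finset.prod_const]
    refine Finset.prod_le_prod' fun y _ => ?_
    rw [← ENNReal.ofReal_mul (hs0 y), ← ENNReal.ofReal_mul (mul_nonneg (hs0 y) (hs0 _))]
    exact ENNReal.ofReal_le_ofReal (sin_mul_sin_mul_pairKernel_le_exp hb0 _ _)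
  -- axis 1 with the regularised sines
  have h1 : ∏ y, ENNReal.ofReal (pairKernel b (Ω y) (Ω (y + Pi.single 1 1))) ≤
      ENNReal.ofReal (Real.exp b / (2 * b)) ^ Fintype.card (Fin (m + 2) → ZMod L) *
        ∏ y, ENNReal.ofReal ((sHat b (Ω y))⁻¹ ^ 2) := by
    have hre : ∏ y, ENNReal.ofReal ((sHat b (Ω y))⁻¹ ^ 2) =
        ∏ y, ENNReal.ofReal ((sHat b (Ω y))⁻¹) * ENNReal.ofReal ((sHat b (Ω (y + Pi.single 1 1)))⁻¹) := by
      rw [Finset.prod_mul_distrib, prod_add_eq_prod (fun y => ENNReal.ofReal ((sHat b (Ω y))⁻¹)),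
        ← Finset.prod_mul_distrib]
      refine Finset.prod_congr rfl fun y _ => ?_
      rw [← ENNReal.ofReal_mul (inv_pos.mpr (sHat_pos hb0 _)).le, sq]
    rw [hre, ← Finset.card_univ, ← Finset.prod_const, ← Finset.prod_mul_distrib]
    refine Finset.prod_le_prod' fun y _ => ?_
    have hq := pairKernel_le_exp_div_sHat' hb (Ω y) (Ω (y + Pi.single 1 1))
    have hs1 := sHat_pos hb0 (Ω y)
    have hs2 := sHat_pos hb0 (Ω (y + Pi.single 1 1))
    rw [← ENNReal.ofReal_mul (inv_pos.mpr hs1).le, ← ENNReal.ofReal_mul (by positivity)]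
    refine ENNReal.ofReal_le_ofReal (hq.trans (le_of_eq ?_))
    field_simp
  -- the other axes
  have h2 : ∏ i : Fin m, ∏ y, ENNReal.ofReal (pairKernel b (Ω y) (Ω (y + Pi.single i.succ.succ 1))) ≤
      (ENNReal.ofReal (Real.exp b) ^ Fintype.card (Fin (m + 2) → ZMod L)) ^ m := by
    calc ∏ i : Fin m, ∏ y, ENNReal.ofReal (pairKernel b (Ω y) (Ω (y + Pi.single i.succ.succ 1)))
        ≤ ∏ _i : Fin m, ENNReal.ofReal (Real.exp b) ^ Fintype.card (Fin (m + 2) → ZMod L) := by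
          refine Finset.prod_le_prod' fun i _ => ?_
          rw [← Finset.card_univ, ← Finset.prod_const]
          refine Finset.prod_le_prod' fun y _ => ENNReal.ofReal_le_ofReal ?_
          refine (pairKernel_le_exp b hb0.le _ _).trans (Real.exp_le_exp.mpr ?_)
          nlinarith [Real.cos_le_one (classAngle (Ω y) - classAngle (Ω (y + Pi.single i.succ.succ 1)))]
      _ = (ENNReal.ofReal (Real.exp b) ^ Fintype.card (Fin (m + 2) → ZMod L)) ^ m := by
          rw [Finset.prod_const, Finset.card_univ, Fintype.card_fin]
  -- assemble
  calc (∏ x, ENNReal.ofReal (Real.sin (classAngle (Ω x)) ^ 2)) *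
        (ENNReal.ofReal C ^ (Fintype.card (Fin (m + 2) → ZMod L) * (m + 2)) *
          ((∏ y, ENNReal.ofReal (pairKernel b (Ω y) (Ω (y + Pi.single 0 1)))) *
            ((∏ y, ENNReal.ofReal (pairKernel b (Ω y) (Ω (y + Pi.single 1 1)))) *
              ∏ i : Fin m, ∏ y, ENNReal.ofReal (pairKernel b (Ω y) (Ω (y + Pi.single i.succ.succ 1))))))
      = ENNReal.ofReal C ^ (Fintype.card (Fin (m + 2) → ZMod L) * (m + 2)) *
          (((∏ x, ENNReal.ofReal (Real.sin (classAngle (Ω x)) ^ 2)) *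
              ∏ y, ENNReal.ofReal (pairKernel b (Ω y) (Ω (y + Pi.single 0 1)))) *
            ((∏ y, ENNReal.ofReal (pairKernel b (Ω y) (Ω (y + Pi.single 1 1)))) *
              ∏ i : Fin m, ∏ y, ENNReal.ofReal (pairKernel b (Ω y) (Ω (y + Pi.single i.succ.succ 1))))) := by ring
    _ ≤ ENNReal.ofReal C ^ (Fintype.card (Fin (m + 2) → ZMod L) * (m + 2)) *
          (ENNReal.ofReal (Real.exp b / (2 * b)) ^ Fintype.card (Fin (m + 2) → ZMod L) *
            ((ENNReal.ofReal (Real.exp b / (2 * b)) ^ Fintype.card (Fin (m + 2) → ZMod L) *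
                ∏ y, ENNReal.ofReal ((sHat b (Ω y))⁻¹ ^ 2)) *
              (ENNReal.ofReal (Real.exp b) ^ Fintype.card (Fin (m + 2) → ZMod L)) ^ m)) :=
        mul_le_mul' le_rfl (mul_le_mul' h0 (mul_le_mul' h1 h2))
    _ = ENNReal.ofReal (C ^ (m + 2) * (Real.exp b / (2 * b)) ^ 2 * Real.exp b ^ m) ^ Fintype.card (Fin (m + 2) → ZMod L) *
          ∏ y, ENNReal.ofReal ((sHat b (Ω y))⁻¹ ^ 2) := by
        rw [ENNReal.ofReal_mul (by positivity), ENNReal.ofReal_mul (by positivity), ENNReal.ofReal_pow hC,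
          ENNReal.ofReal_pow (by positivity), ENNReal.ofReal_pow (Real.exp_pos _).le, mul_pow, mul_pow, ← pow_mul,
          ← pow_mul, ← pow_mul, mul_comm (Fintype.card (Fin (m + 2) → ZMod L))]
        ring

/-- `ŝ` is continuous. [folklore] -/
private theorem continuous_sHat (b : ℝ) : Continuous (sHat b) := by
  unfold sHat
  have h : Continuous (htr : SU2 → ℝ) := (Complex.continuous_re.comp (continuous_subtype_val.matrix_trace)).div_const _
  exact ((Real.continuous_sin.comp (Real.continuous_arccos.comp h))).max continuous_const

/-- `ŝ⁻¹ ^ k` is continuous (`b > 0`). [folklore] -/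
private theorem continuous_sHat_inv_pow {b : ℝ} (hb : 0 < b) (k : ℕ) : Continuous fun g : SU2 => (sHat b g)⁻¹ ^ k :=
  ((continuous_sHat b).inv₀ fun g => (sHat_pos hb g).ne').pow k

/-- **THE POINT-DEFECT PATTERN BOUND** (TY (3.18)–(3.19), with `Z_xy` replaced by the crude site integral): for
`d = m + 2 ≥ 2`, `J > 0` and `b = b_{L₀−1}(J) ≥ 1/2`,
`S(∏_x (1 − |½trΩ_x|)) ≤ [2 C^{d} (e^b/2b)² e^{b(d−2)}]^{|Λ|}`. [cite: TomboulisYaffe1985, §III.C (3.18)–(3.19), p. 324] -/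
theorem spinIntegral_pointDefect_le {J : ℝ} (hJ : 0 < J) (hb : 1 / 2 ≤ bSeq J (L₀ - 1)) :
    spinIntegral (d := m + 2) (L := L) L₀ J (fun Ω => ENNReal.ofReal (∏ x, (1 - |htr (Ω x)|))) ≤
      ENNReal.ofReal (2 * (cSeq J (L₀ - 1) ^ (m + 2) * (Real.exp (bSeq J (L₀ - 1)) / (2 * bSeq J (L₀ - 1))) ^ 2 *
        Real.exp (bSeq J (L₀ - 1)) ^ m)) ^ Fintype.card (Fin (m + 2) → ZMod L) := by
  set C := cSeq J (L₀ - 1) with hC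
  set b := bSeq J (L₀ - 1) with hbdef
  have hb0 : 0 < b := by linarith
  have hC0 : 0 ≤ C := (cSeq_pos J _).le
  set α : ℝ := C ^ (m + 2) * (Real.exp b / (2 * b)) ^ 2 * Real.exp b ^ m with hα
  have hα0 : 0 ≤ α := by positivity
  -- pointwise
  have hpt : ∀ Ω : (Fin (m + 2) → ZMod L) → SU2,
      ENNReal.ofReal (∏ x, (1 - |htr (Ω x)|)) * ∏ bd : (Fin (m + 2) → ZMod L) × Fin (m + 2),
          transferKernel (fundamentalRep (Fin 2)) L₀ J (Ω bd.1) (Ω (bd.1 + Pi.single bd.2 1)) ≤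
        ENNReal.ofReal α ^ Fintype.card (Fin (m + 2) → ZMod L) * ∏ y, ENNReal.ofReal ((sHat b (Ω y))⁻¹ ^ 2) := by
    intro Ω
    refine le_trans (mul_le_mul' ?_ (Finset.prod_le_prod' fun bd _ =>
      transferKernel_le_pairKernel J (Ω bd.1) (Ω (bd.1 + Pi.single bd.2 1)) L₀ hJ)) (pointDefect_pointwise hb hC0 Ω)
    rw [ENNReal.ofReal_prod_of_nonneg (fun x _ => ?_)]
    · exact Finset.prod_le_prod' fun x _ => ENNReal.ofReal_le_ofReal (one_sub_abs_htr_le_sin_sq _)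
    · have := (htr_mem_Icc (Ω x)); have := abs_le.mpr ⟨this.1, this.2⟩; linarith
  refine (lintegral_mono hpt).trans ?_
  have hm : Measurable (fun Ω : (Fin (m + 2) → ZMod L) → SU2 => ∏ y, ENNReal.ofReal ((sHat b (Ω y))⁻¹ ^ 2)) :=
    Finset.measurable_prod _ fun y _ =>
      (ENNReal.measurable_ofReal.comp (continuous_sHat_inv_pow hb0 2).measurable).comp (measurable_pi_apply y)
  rw [lintegral_const_mul _ hm,
    lintegral_pi_finset_prod _ (fun _ g => ENNReal.ofReal ((sHat b g)⁻¹ ^ 2))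
      (fun _ => ENNReal.measurable_ofReal.comp (continuous_sHat_inv_pow hb0 2).measurable),
    ← ofReal_integral_eq_lintegral_ofReal ((continuous_sHat_inv_pow hb0 2).integrable_of_hasCompactSupport
      (HasCompactSupport.of_compactSpace _)) (Eventually.of_forall fun g => by positivity),
    Finset.prod_const, Finset.card_univ, ← mul_pow, mul_comm (2 : ℝ), ENNReal.ofReal_mul hα0]
  exact pow_le_pow_left' (mul_le_mul' le_rfl (ENNReal.ofReal_le_ofReal (integral_sHat_inv_sq_le hb0))) _

end PointDefect

/-! ### §7. The wall pattern of one axis (TY (3.20)–(3.24)): `S(1_{W_i}) ≤ [C^d (2b)^{-d} e^{b(d−1)} · 2(2^{d−1}e^b + (2b)^{2d−2}e^{b/2})]^{|Λ|}` -/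

section Wall

variable {m L L₀ : ℕ} [NeZero L] [NeZero L₀]

/-- One axis with the regularised bound: `∏_y J(Ω_y, Ω_{y+e_j}) ≤ (e^b/2b)^{|Λ|} ∏_y ŝ_y⁻²`. [cite: TomboulisYaffe1985, §III.C (3.17), p. 324] -/
theorem prod_pairKernel_axis_le {b : ℝ} (hb : 1 / 2 ≤ b) (j : Fin (m + 1)) (Ω : (Fin (m + 1) → ZMod L) → SU2) :
    ∏ y, ENNReal.ofReal (pairKernel b (Ω y) (Ω (y + Pi.single j 1))) ≤
      ENNReal.ofReal (Real.exp b / (2 * b)) ^ Fintype.card (Fin (m + 1) → ZMod L) *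
        ∏ y, ENNReal.ofReal ((sHat b (Ω y))⁻¹ ^ 2) := by
  have hb0 : 0 < b := by linarith
  have hre : ∏ y, ENNReal.ofReal ((sHat b (Ω y))⁻¹ ^ 2) =
      ∏ y, ENNReal.ofReal ((sHat b (Ω y))⁻¹) * ENNReal.ofReal ((sHat b (Ω (y + Pi.single j 1)))⁻¹) := by
    rw [Finset.prod_mul_distrib, prod_add_eq_prod (fun y => ENNReal.ofReal ((sHat b (Ω y))⁻¹)),
      ← Finset.prod_mul_distrib]
    refine Finset.prod_congr rfl fun y _ => ?_
    rw [← ENNReal.ofReal_mul (inv_pos.mpr (sHat_pos hb0 _)).le, sq]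
  rw [hre, ← Finset.card_univ, ← Finset.prod_const, ← Finset.prod_mul_distrib]
  refine Finset.prod_le_prod' fun y _ => ?_
  have hq := pairKernel_le_exp_div_sHat' hb (Ω y) (Ω (y + Pi.single j 1))
  have hs1 := sHat_pos hb0 (Ω y)
  have hs2 := sHat_pos hb0 (Ω (y + Pi.single j 1))
  rw [← ENNReal.ofReal_mul (inv_pos.mpr hs1).le, ← ENNReal.ofReal_mul (by positivity)]
  refine ENNReal.ofReal_le_ofReal (hq.trans (le_of_eq ?_))
  field_simp

/-- The wall indicator of the axis `i` (all bonds `⟨y, y+e_i⟩` are walls). [cite: TomboulisYaffe1985, §III.C (3.24)–(3.26), p. 325] -/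
def wallInd (i : Fin (m + 1)) (Ω : (Fin (m + 1) → ZMod L) → SU2) : ℝ≥0∞ :=
  if ∀ y, ¬ (0 ≤ htr (Ω y) ↔ 0 ≤ htr (Ω (y + Pi.single i 1))) then 1 else 0

/-- **The wall axis**: `1_{W_i} ∏_y J(Ω_y,Ω_{y+e_i}) ≤ (1/2b)^{|Λ|} ∏_y e^{b sin²ω_y} ŝ_y⁻²` (the sites decouple).
[cite: TomboulisYaffe1985, §III.C (3.20), p. 324] -/
theorem wallInd_mul_prod_pairKernel_le {b : ℝ} (hb : 1 / 2 ≤ b) (i : Fin (m + 1)) (Ω : (Fin (m + 1) → ZMod L) → SU2) :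
    wallInd i Ω * ∏ y, ENNReal.ofReal (pairKernel b (Ω y) (Ω (y + Pi.single i 1))) ≤
      ENNReal.ofReal (1 / (2 * b)) ^ Fintype.card (Fin (m + 1) → ZMod L) *
        ∏ y, ENNReal.ofReal (Real.exp (b * Real.sin (classAngle (Ω y)) ^ 2)) * ENNReal.ofReal ((sHat b (Ω y))⁻¹ ^ 2) := by
  have hb0 : 0 < b := by linarith
  unfold wallInd
  split_ifs with hW
  · rw [one_mul]
    -- reindex the right-hand side into bond form
    have ha : ∏ y, ENNReal.ofReal (Real.exp (b * Real.sin (classAngle (Ω y)) ^ 2)) =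
        ∏ y, ENNReal.ofReal (Real.exp (b * Real.sin (classAngle (Ω y)) ^ 2 / 2)) *
          ENNReal.ofReal (Real.exp (b * Real.sin (classAngle (Ω (y + Pi.single i 1))) ^ 2 / 2)) := by
      rw [Finset.prod_mul_distrib,
        prod_add_eq_prod (fun y => ENNReal.ofReal (Real.exp (b * Real.sin (classAngle (Ω y)) ^ 2 / 2))),
        ← Finset.prod_mul_distrib]
      refine Finset.prod_congr rfl fun y _ => ?_
      rw [← ENNReal.ofReal_mul (Real.exp_pos _).le, ← Real.exp_add]
      congr 2; ring
    have hc : ∏ y, ENNReal.ofReal ((sHat b (Ω y))⁻¹ ^ 2) =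
        ∏ y, ENNReal.ofReal ((sHat b (Ω y))⁻¹) * ENNReal.ofReal ((sHat b (Ω (y + Pi.single i 1)))⁻¹) := by
      rw [Finset.prod_mul_distrib, prod_add_eq_prod (fun y => ENNReal.ofReal ((sHat b (Ω y))⁻¹)),
        ← Finset.prod_mul_distrib]
      refine Finset.prod_congr rfl fun y _ => ?_
      rw [← ENNReal.ofReal_mul (inv_pos.mpr (sHat_pos hb0 _)).le, sq]
    have hre : ∏ y, ENNReal.ofReal (Real.exp (b * Real.sin (classAngle (Ω y)) ^ 2)) * ENNReal.ofReal ((sHat b (Ω y))⁻¹ ^ 2) =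
        ∏ y, (ENNReal.ofReal (Real.exp (b * Real.sin (classAngle (Ω y)) ^ 2 / 2)) *
          ENNReal.ofReal (Real.exp (b * Real.sin (classAngle (Ω (y + Pi.single i 1))) ^ 2 / 2))) *
          (ENNReal.ofReal ((sHat b (Ω y))⁻¹) * ENNReal.ofReal ((sHat b (Ω (y + Pi.single i 1)))⁻¹)) := by
      rw [Finset.prod_mul_distrib, ha, hc, ← Finset.prod_mul_distrib]
    rw [hre, ← Finset.card_univ, ← Finset.prod_const, ← Finset.prod_mul_distrib]
    refine Finset.prod_le_prod' fun y _ => ?_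
    have hq := pairKernel_le_of_wall hb (hW y)
    have hs1 := sHat_pos hb0 (Ω y)
    have hs2 := sHat_pos hb0 (Ω (y + Pi.single i 1))
    rw [← ENNReal.ofReal_mul (Real.exp_pos _).le, ← ENNReal.ofReal_mul (inv_pos.mpr hs1).le,
      ← ENNReal.ofReal_mul (by positivity), ← ENNReal.ofReal_mul (by positivity)]
    refine ENNReal.ofReal_le_ofReal (hq.trans (le_of_eq ?_))
    field_simp
  · rw [zero_mul]; exact bot_le

/-- **Pointwise bound for the wall pattern** (d = m+1, wall axis `i`):
`1_{W_i} ∏_{⟨y,j⟩} C·J(Ω_y,Ω_{y+e_j}) ≤ [C^{m+1} (1/2b) (e^b/2b)^m]^{|Λ|} ∏_y e^{b sin²ω_y} ŝ_y^{−(2m+2)}`.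
[cite: TomboulisYaffe1985, §III.C (3.20)–(3.24), pp. 324–325] -/
theorem wall_pointwise {b C : ℝ} (hb : 1 / 2 ≤ b) (hC : 0 ≤ C) (i : Fin (m + 1)) (Ω : (Fin (m + 1) → ZMod L) → SU2) :
    wallInd i Ω * ∏ bd : (Fin (m + 1) → ZMod L) × Fin (m + 1), ENNReal.ofReal (C * pairKernel b (Ω bd.1) (Ω (bd.1 + Pi.single bd.2 1))) ≤
      ENNReal.ofReal (C ^ (m + 1) * (1 / (2 * b)) * (Real.exp b / (2 * b)) ^ m) ^ Fintype.card (Fin (m + 1) → ZMod L) *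
        ∏ y, ENNReal.ofReal (Real.exp (b * Real.sin (classAngle (Ω y)) ^ 2) * (sHat b (Ω y))⁻¹ ^ (2 * m + 2)) := by
  have hb0 : 0 < b := by linarith
  have hsplitC : ∏ bd : (Fin (m + 1) → ZMod L) × Fin (m + 1),
      ENNReal.ofReal (C * pairKernel b (Ω bd.1) (Ω (bd.1 + Pi.single bd.2 1))) =
      ENNReal.ofReal C ^ (Fintype.card (Fin (m + 1) → ZMod L) * (m + 1)) *
        ∏ j : Fin (m + 1), ∏ y, ENNReal.ofReal (pairKernel b (Ω y) (Ω (y + Pi.single j 1))) := by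
    simp_rw [ENNReal.ofReal_mul hC]
    rw [Finset.prod_mul_distrib, Finset.prod_const, Finset.card_univ, Fintype.card_prod, Fintype.card_fin,
      Fintype.prod_prod_type, Finset.prod_comm]
  rw [hsplitC, ← Finset.mul_prod_erase Finset.univ _ (Finset.mem_univ i)]
  have hW := wallInd_mul_prod_pairKernel_le hb i Ω
  have hrest : ∏ j ∈ Finset.univ.erase i, ∏ y, ENNReal.ofReal (pairKernel b (Ω y) (Ω (y + Pi.single j 1))) ≤
      (ENNReal.ofReal (Real.exp b / (2 * b)) ^ Fintype.card (Fin (m + 1) → ZMod L) *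
        ∏ y, ENNReal.ofReal ((sHat b (Ω y))⁻¹ ^ 2)) ^ m := by
    calc ∏ j ∈ Finset.univ.erase i, ∏ y, ENNReal.ofReal (pairKernel b (Ω y) (Ω (y + Pi.single j 1)))
        ≤ ∏ _j ∈ Finset.univ.erase i, (ENNReal.ofReal (Real.exp b / (2 * b)) ^ Fintype.card (Fin (m + 1) → ZMod L) *
            ∏ y, ENNReal.ofReal ((sHat b (Ω y))⁻¹ ^ 2)) := Finset.prod_le_prod' fun j _ => prod_pairKernel_axis_le hb j Ω
      _ = _ := by rw [Finset.prod_const, Finset.card_erase_of_mem (Finset.mem_univ i), Finset.card_univ, Fintype.card_fin,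
            Nat.add_sub_cancel]
  calc wallInd i Ω * (ENNReal.ofReal C ^ (Fintype.card (Fin (m + 1) → ZMod L) * (m + 1)) *
        ((∏ y, ENNReal.ofReal (pairKernel b (Ω y) (Ω (y + Pi.single i 1)))) *
          ∏ j ∈ Finset.univ.erase i, ∏ y, ENNReal.ofReal (pairKernel b (Ω y) (Ω (y + Pi.single j 1)))))
      = ENNReal.ofReal C ^ (Fintype.card (Fin (m + 1) → ZMod L) * (m + 1)) *
          ((wallInd i Ω * ∏ y, ENNReal.ofReal (pairKernel b (Ω y) (Ω (y + Pi.single i 1)))) *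
            ∏ j ∈ Finset.univ.erase i, ∏ y, ENNReal.ofReal (pairKernel b (Ω y) (Ω (y + Pi.single j 1)))) := by ring
    _ ≤ ENNReal.ofReal C ^ (Fintype.card (Fin (m + 1) → ZMod L) * (m + 1)) *
          ((ENNReal.ofReal (1 / (2 * b)) ^ Fintype.card (Fin (m + 1) → ZMod L) *
              ∏ y, ENNReal.ofReal (Real.exp (b * Real.sin (classAngle (Ω y)) ^ 2)) * ENNReal.ofReal ((sHat b (Ω y))⁻¹ ^ 2)) *
            (ENNReal.ofReal (Real.exp b / (2 * b)) ^ Fintype.card (Fin (m + 1) → ZMod L) *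
              ∏ y, ENNReal.ofReal ((sHat b (Ω y))⁻¹ ^ 2)) ^ m) := mul_le_mul' le_rfl (mul_le_mul' hW hrest)
    _ = ENNReal.ofReal (C ^ (m + 1) * (1 / (2 * b)) * (Real.exp b / (2 * b)) ^ m) ^ Fintype.card (Fin (m + 1) → ZMod L) *
          ∏ y, ENNReal.ofReal (Real.exp (b * Real.sin (classAngle (Ω y)) ^ 2) * (sHat b (Ω y))⁻¹ ^ (2 * m + 2)) := by
        have hy : ∀ y : Fin (m + 1) → ZMod L,
            ENNReal.ofReal (Real.exp (b * Real.sin (classAngle (Ω y)) ^ 2)) * ENNReal.ofReal ((sHat b (Ω y))⁻¹ ^ 2) *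
              ENNReal.ofReal ((sHat b (Ω y))⁻¹ ^ 2) ^ m =
            ENNReal.ofReal (Real.exp (b * Real.sin (classAngle (Ω y)) ^ 2) * (sHat b (Ω y))⁻¹ ^ (2 * m + 2)) := by
          intro y
          have h0 : 0 ≤ (sHat b (Ω y))⁻¹ := (inv_pos.mpr (sHat_pos hb0 _)).le
          rw [← ENNReal.ofReal_pow (pow_nonneg h0 2), ← ENNReal.ofReal_mul (Real.exp_pos _).le,
            ← ENNReal.ofReal_mul (by positivity), ← pow_mul]
          congr 1; ring
        have hprod : (∏ y, ENNReal.ofReal (Real.exp (b * Real.sin (classAngle (Ω y)) ^ 2)) *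
            ENNReal.ofReal ((sHat b (Ω y))⁻¹ ^ 2)) * (∏ y, ENNReal.ofReal ((sHat b (Ω y))⁻¹ ^ 2)) ^ m =
            ∏ y, ENNReal.ofReal (Real.exp (b * Real.sin (classAngle (Ω y)) ^ 2) * (sHat b (Ω y))⁻¹ ^ (2 * m + 2)) := by
          rw [← Finset.prod_pow, ← Finset.prod_mul_distrib]
          exact Finset.prod_congr rfl fun y _ => hy y
        rw [ENNReal.ofReal_mul (by positivity), ENNReal.ofReal_mul (by positivity), ENNReal.ofReal_pow hC,
          ENNReal.ofReal_pow (by positivity), ← hprod]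
        ring

/-- The wall set of the axis `i` is measurable. [folklore] -/
private theorem measurableSet_wall (i : Fin (m + 1)) :
    MeasurableSet {Ω : (Fin (m + 1) → ZMod L) → SU2 | ∀ y, ¬ (0 ≤ htr (Ω y) ↔ 0 ≤ htr (Ω (y + Pi.single i 1)))} := by
  have hc : Continuous (htr : SU2 → ℝ) := (Complex.continuous_re.comp (continuous_subtype_val.matrix_trace)).div_const _
  have hset : {Ω : (Fin (m + 1) → ZMod L) → SU2 | ∀ y, ¬ (0 ≤ htr (Ω y) ↔ 0 ≤ htr (Ω (y + Pi.single i 1)))} =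
      ⋂ y, {Ω | (0 ≤ htr (Ω y) ↔ 0 ≤ htr (Ω (y + Pi.single i 1)))}ᶜ := by
    ext Ω; simp
  rw [hset]
  refine MeasurableSet.iInter fun y => MeasurableSet.compl ?_
  have h1 : MeasurableSet {Ω : (Fin (m + 1) → ZMod L) → SU2 | 0 ≤ htr (Ω y)} :=
    measurableSet_le measurable_const (hc.measurable.comp (measurable_pi_apply y))
  have h2 : MeasurableSet {Ω : (Fin (m + 1) → ZMod L) → SU2 | 0 ≤ htr (Ω (y + Pi.single i 1))} :=
    measurableSet_le measurable_const (hc.measurable.comp (measurable_pi_apply _))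
  have : {Ω : (Fin (m + 1) → ZMod L) → SU2 | (0 ≤ htr (Ω y) ↔ 0 ≤ htr (Ω (y + Pi.single i 1)))} =
      ({Ω | 0 ≤ htr (Ω y)} ∩ {Ω | 0 ≤ htr (Ω (y + Pi.single i 1))}) ∪
        ({Ω | 0 ≤ htr (Ω y)}ᶜ ∩ {Ω | 0 ≤ htr (Ω (y + Pi.single i 1))}ᶜ) := by
    ext Ω; simp only [Set.mem_setOf_eq, Set.mem_union, Set.mem_inter_iff, Set.mem_compl_iff]; tauto
  rw [this]
  exact (h1.inter h2).union (h1.compl.inter h2.compl)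

/-- `wallInd` is measurable. [folklore] -/
private theorem measurable_wallInd (i : Fin (m + 1)) : Measurable (wallInd (L := L) i) := by
  unfold wallInd
  exact Measurable.ite (measurableSet_wall i) measurable_const measurable_const

/-- **THE WALL PATTERN BOUND** (TY (3.20)–(3.24)): for `d = m + 1`, `J > 0`, `b = b_{L₀−1}(J) ≥ 1/2` and any axis `i`,
`S(1_{W_i}) ≤ [C^{d} (1/2b)(e^b/2b)^{d−1} · 2(2^{d−1} e^b + (2b)^{2d−2} e^{b/2})]^{|Λ|}`.
[cite: TomboulisYaffe1985, §III.C (3.20)–(3.24), pp. 324–325] -/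
theorem spinIntegral_wall_le {J : ℝ} (hJ : 0 < J) (hb : 1 / 2 ≤ bSeq J (L₀ - 1)) (i : Fin (m + 1)) :
    spinIntegral (d := m + 1) (L := L) L₀ J (wallInd i) ≤
      ENNReal.ofReal (cSeq J (L₀ - 1) ^ (m + 1) * (1 / (2 * bSeq J (L₀ - 1))) *
          (Real.exp (bSeq J (L₀ - 1)) / (2 * bSeq J (L₀ - 1))) ^ m *
        (2 * (2 ^ m * Real.exp (bSeq J (L₀ - 1)) + (2 * bSeq J (L₀ - 1)) ^ (2 * m) * Real.exp (bSeq J (L₀ - 1) / 2)))) ^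
        Fintype.card (Fin (m + 1) → ZMod L) := by
  set C := cSeq J (L₀ - 1) with hC
  set b := bSeq J (L₀ - 1) with hbdef
  have hb0 : 0 < b := by linarith
  have hC0 : 0 ≤ C := (cSeq_pos J _).le
  set α : ℝ := C ^ (m + 1) * (1 / (2 * b)) * (Real.exp b / (2 * b)) ^ m with hα
  have hα0 : 0 ≤ α := by positivity
  set ψ : SU2 → ℝ := fun g => Real.exp (b * Real.sin (classAngle g) ^ 2) * (sHat b g)⁻¹ ^ (2 * m + 2) with hψ
  have hψc : Continuous ψ :=
    (Real.continuous_exp.comp (continuous_const.mul ((Real.continuous_sin.comp (Real.continuous_arccos.comp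
      ((Complex.continuous_re.comp (continuous_subtype_val.matrix_trace)).div_const _))).pow 2))).mul
      (continuous_sHat_inv_pow hb0 _)
  have hpt : ∀ Ω : (Fin (m + 1) → ZMod L) → SU2,
      wallInd i Ω * ∏ bd : (Fin (m + 1) → ZMod L) × Fin (m + 1),
          transferKernel (fundamentalRep (Fin 2)) L₀ J (Ω bd.1) (Ω (bd.1 + Pi.single bd.2 1)) ≤
        ENNReal.ofReal α ^ Fintype.card (Fin (m + 1) → ZMod L) * ∏ y, ENNReal.ofReal (ψ (Ω y)) := fun Ω =>
    le_trans (mul_le_mul' le_rfl (Finset.prod_le_prod' fun bd _ =>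
      transferKernel_le_pairKernel J (Ω bd.1) (Ω (bd.1 + Pi.single bd.2 1)) L₀ hJ)) (wall_pointwise hb hC0 i Ω)
  refine (lintegral_mono hpt).trans ?_
  have hm : Measurable (fun Ω : (Fin (m + 1) → ZMod L) → SU2 => ∏ y, ENNReal.ofReal (ψ (Ω y))) :=
    Finset.measurable_prod _ fun y _ => (ENNReal.measurable_ofReal.comp hψc.measurable).comp (measurable_pi_apply y)
  rw [lintegral_const_mul _ hm, lintegral_pi_finset_prod _ (fun _ g => ENNReal.ofReal (ψ g))
      (fun _ => ENNReal.measurable_ofReal.comp hψc.measurable),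
    ← ofReal_integral_eq_lintegral_ofReal (hψc.integrable_of_hasCompactSupport (HasCompactSupport.of_compactSpace _))
      (Eventually.of_forall fun g => by
        simp only [hψ, Pi.zero_apply]
        exact mul_nonneg (Real.exp_pos _).le (pow_nonneg (inv_pos.mpr (sHat_pos hb0 g)).le _)),
    Finset.prod_const, Finset.card_univ, ← mul_pow, ENNReal.ofReal_mul hα0]
  exact pow_le_pow_left' (mul_le_mul' le_rfl (ENNReal.ofReal_le_ofReal (integral_exp_mul_sHat_inv_pow_le hb m))) _

end Wall

/-! ### §8. Assembly: the per-site ratios and their decay; X'' -/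

section Assembly

variable {m L L₀ : ℕ} [NeZero L] [NeZero L₀]

/-- `Z ≥ [μ(cap)·kernelScale^{d}]^{|Λ|}` for a general `L₀ ≥ 1`. [cite: TomboulisYaffe1985, §III (3.15)–(3.18), p. 324] -/
theorem pow_le_spinIntegral_one' {d : ℕ} (L₀ : ℕ) [NeZero L₀] {J : ℝ} (hJ : 1 ≤ J) :
    ENNReal.ofReal ((QuantumFieldTheory.haarProbability SU2).real (polarCap (Real.sqrt J)⁻¹) *
        kernelScale (L₀ - 1) J ^ d) ^ Fintype.card (Fin d → ZMod L) ≤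
      spinIntegral (d := d) (L := L) L₀ J (fun _ => 1) := by
  obtain ⟨n, rfl⟩ : ∃ n, L₀ = n + 1 := ⟨L₀ - 1, (Nat.succ_pred_eq_of_pos (Nat.pos_of_neZero L₀)).symm⟩
  simpa only [Nat.add_sub_cancel] using pow_le_spinIntegral_one (d := d) (L := L) (n := n) hJ

/-- The cap mass is positive for `J ≥ 1` (indeed `≥ (8/3π³) J^{-3/2}`). [cite: TomboulisYaffe1985, App. III.B, p. 338] -/
theorem cube_le_capMass {J : ℝ} (hJ : 1 ≤ J) :
    8 / (3 * Real.pi ^ 3) * ((Real.sqrt J)⁻¹) ^ 3 ≤ (QuantumFieldTheory.haarProbability SU2).real (polarCap (Real.sqrt J)⁻¹) := by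
  have hs : 1 ≤ Real.sqrt J := by rw [← Real.sqrt_one]; exact Real.sqrt_le_sqrt hJ
  refine cube_le_measureReal_polarCap (by positivity) ?_
  calc (Real.sqrt J)⁻¹ ≤ 1 := inv_le_one_of_one_le₀ hs
    _ ≤ Real.pi / 2 := by linarith [Real.pi_gt_three]

/-- The per-site ratio of the point-defect pattern: `r₁ = 2(2b)^{-2}/(μ(cap) κ^{d})`. [cite: TomboulisYaffe1985, §III.C (3.19), p. 324] -/
def ratioPoint (m n : ℕ) (J : ℝ) : ℝ :=
  2 / ((2 * bSeq J n) ^ 2 *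
    ((QuantumFieldTheory.haarProbability SU2).real (polarCap (Real.sqrt J)⁻¹) * kernelRatioConst n ^ (m + 2)))

/-- The per-site ratio of the wall pattern:
`r₂ = 2(2b)^{-d}(2^{d-1}e^b + (2b)^{2d-2}e^{b/2})/(e^b μ(cap) κ^{d})`. [cite: TomboulisYaffe1985, §III.C (3.24), p. 325] -/
def ratioWall (m n : ℕ) (J : ℝ) : ℝ :=
  2 * (2 ^ (m + 1) * Real.exp (bSeq J n) + (2 * bSeq J n) ^ (2 * (m + 1)) * Real.exp (bSeq J n / 2)) /
    ((2 * bSeq J n) ^ (m + 2) * Real.exp (bSeq J n) *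
      ((QuantumFieldTheory.haarProbability SU2).real (polarCap (Real.sqrt J)⁻¹) * kernelRatioConst n ^ (m + 2)))

/-- `r₁ ≥ 0`. [cite: TomboulisYaffe1985, §III.C (3.19), p. 324] -/
theorem ratioPoint_nonneg (m n : ℕ) (J : ℝ) : 0 ≤ ratioPoint m n J := by
  unfold ratioPoint
  exact div_nonneg (by positivity) (mul_nonneg (sq_nonneg _)
    (mul_nonneg measureReal_nonneg (pow_nonneg (kernelRatioConst_pos n).le _)))

/-- `r₂ ≥ 0`. [cite: TomboulisYaffe1985, §III.C (3.24), p. 325] -/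
theorem ratioWall_nonneg (m n : ℕ) {J : ℝ} (hJ : 0 ≤ J) : 0 ≤ ratioWall m n J := by
  unfold ratioWall
  have := bSeq_nonneg hJ n
  exact div_nonneg (by positivity) (mul_nonneg (mul_nonneg (by positivity) (Real.exp_pos _).le)
    (mul_nonneg measureReal_nonneg (pow_nonneg (kernelRatioConst_pos n).le _)))

/-- **(P1) at `J_M = 0`**: `⟨∏_x (1 − |½trΩ_x|)⟩_{J,0} ≤ r₁(J)^{|Λ|}` for `J ≥ 1`, `b_{L₀−1}(J) ≥ 1/2`, `d = m + 2`.
[cite: TomboulisYaffe1985, §III.C (3.18)–(3.19), p. 324] -/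
theorem expectation_pointDefect_le {J : ℝ} (hJ : 1 ≤ J) (hb : 1 / 2 ≤ bSeq J (L₀ - 1)) :
    expectation (fundamentalRep (Fin 2)) J 0 (fun U : Config (m + 2) L₀ L SU2 => ∏ x, (1 - |halfTrace U x|)) ≤
      ratioPoint m (L₀ - 1) J ^ Fintype.card (Fin (m + 2) → ZMod L) := by
  have hJ0 : 0 < J := zero_lt_one.trans_le hJ
  have hC : 0 < cSeq J (L₀ - 1) := cSeq_pos J _
  have hb0 : 0 < bSeq J (L₀ - 1) := by linarith
  have hκ : 0 < kernelRatioConst (L₀ - 1) := kernelRatioConst_pos _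
  have hcap : 0 < (QuantumFieldTheory.haarProbability SU2).real (polarCap (Real.sqrt J)⁻¹) :=
    lt_of_lt_of_le (by positivity) (cube_le_capMass hJ)
  have hc : Continuous (htr : SU2 → ℝ) := (Complex.continuous_re.comp (continuous_subtype_val.matrix_trace)).div_const _
  have hGm : Measurable fun Ω : (Fin (m + 2) → ZMod L) → SU2 => ∏ x, (1 - |htr (Ω x)|) :=
    Finset.measurable_prod _ fun x _ => measurable_const.sub ((hc.measurable.comp (measurable_pi_apply x)).abs)
  have hG0 : ∀ Ω : (Fin (m + 2) → ZMod L) → SU2, 0 ≤ ∏ x, (1 - |htr (Ω x)|) := fun Ω =>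
    Finset.prod_nonneg fun x _ => by
      have := htr_mem_Icc (Ω x); have := abs_le.mpr ⟨this.1, this.2⟩; linarith
  have ha : 0 ≤ 2 * (cSeq J (L₀ - 1) ^ (m + 2) * (Real.exp (bSeq J (L₀ - 1)) / (2 * bSeq J (L₀ - 1))) ^ 2 *
      Real.exp (bSeq J (L₀ - 1)) ^ m) := by positivity
  have hβ : 0 < (QuantumFieldTheory.haarProbability SU2).real (polarCap (Real.sqrt J)⁻¹) * kernelScale (L₀ - 1) J ^ (m + 2) :=
    mul_pos hcap (pow_pos (kernelScale_pos (L₀ - 1) J) (m + 2))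
  have hnum := spinIntegral_pointDefect_le (m := m) (L := L) (L₀ := L₀) hJ0 hb
  rw [← ENNReal.ofReal_pow ha] at hnum
  have hden := pow_le_spinIntegral_one' (d := m + 2) (L := L) L₀ hJ
  rw [← ENNReal.ofReal_pow hβ.le] at hden
  have key := expectation_le_div (L₀ := L₀) J _ hGm hG0 (pow_nonneg ha _) (pow_pos hβ _) hnum hden
  refine key.trans (le_of_eq ?_)
  rw [← div_pow]
  congr 1
  unfold ratioPoint kernelScale
  have hE : Real.exp (bSeq J (L₀ - 1)) ≠ 0 := (Real.exp_pos _).ne'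
  have hb' : bSeq J (L₀ - 1) ≠ 0 := hb0.ne'
  have hC' : cSeq J (L₀ - 1) ≠ 0 := hC.ne'
  have hκ' : kernelRatioConst (L₀ - 1) ≠ 0 := hκ.ne'
  have hcap' : (QuantumFieldTheory.haarProbability SU2).real (polarCap (Real.sqrt J)⁻¹) ≠ 0 := hcap.ne'
  field_simp
  ring

/-- The real-valued wall pattern of the axis `i` on twist configurations. [cite: TomboulisYaffe1985, §III.C (3.24)–(3.26), p. 325] -/
def wallFun (i : Fin (m + 1)) (Ω : (Fin (m + 1) → ZMod L) → SU2) : ℝ :=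
  if ∀ y, ¬ (0 ≤ htr (Ω y) ↔ 0 ≤ htr (Ω (y + Pi.single i 1))) then 1 else 0

/-- `ofReal ∘ wallFun = wallInd`. [cite: TomboulisYaffe1985, §III.C (3.24), p. 325] -/
theorem ofReal_wallFun (i : Fin (m + 1)) (Ω : (Fin (m + 1) → ZMod L) → SU2) :
    ENNReal.ofReal (wallFun i Ω) = wallInd i Ω := by
  unfold wallFun wallInd
  split_ifs <;> simp

omit [NeZero L₀] in
/-- The wall event of all bonds of one axis is the wall pattern of the Polyakov lines. [cite: TomboulisYaffe1985, §III.C (3.24)–(3.26), p. 325] -/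
theorem wallEvent_indicator_eq (i : Fin (m + 1)) (U : Config (m + 1) L₀ L SU2) :
    (wallEvent (L₀ := L₀) ((Finset.univ : Finset (Fin (m + 1) → ZMod L)) ×ˢ {i})).indicator (1 : Config (m + 1) L₀ L SU2 → ℝ) U =
      wallFun i (polyakovLine U) := by
  unfold wallFun
  by_cases h : ∀ y, ¬ (0 ≤ htr (polyakovLine U y) ↔ 0 ≤ htr (polyakovLine U (y + Pi.single i 1)))
  · rw [if_pos h, Set.indicator_of_mem, Pi.one_apply]
    simp only [wallEvent, Set.mem_setOf_eq]
    intro b hb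
    rw [Finset.mem_product, Finset.mem_singleton] at hb
    rw [halfTrace_eq_htr, halfTrace_eq_htr, hb.2]
    exact h b.1
  · rw [if_neg h, Set.indicator_of_notMem]
    simp only [wallEvent, Set.mem_setOf_eq]
    intro hU
    exact h fun y => hU (y, i) (by simp)

/-- `wallFun` is measurable. [folklore] -/
private theorem measurable_wallFun (i : Fin (m + 1)) : Measurable (wallFun (L := L) i) := by
  unfold wallFun
  exact Measurable.ite (measurableSet_wall i) measurable_const measurable_const

/-- **(P2) at `J_M = 0`**: `⟨1_{W_i}⟩_{J,0} ≤ r₂(J)^{|Λ|}` for `J ≥ 1`, `b_{L₀−1}(J) ≥ 1/2`, `d = m + 2`, any axis `i`.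
[cite: TomboulisYaffe1985, §III.C (3.20)–(3.24), pp. 324–325] -/
theorem expectation_axisWall_le {J : ℝ} (hJ : 1 ≤ J) (hb : 1 / 2 ≤ bSeq J (L₀ - 1)) (i : Fin (m + 2)) :
    expectation (fundamentalRep (Fin 2)) J 0
        ((wallEvent (L₀ := L₀) ((Finset.univ : Finset (Fin (m + 2) → ZMod L)) ×ˢ {i})).indicator 1) ≤
      ratioWall m (L₀ - 1) J ^ Fintype.card (Fin (m + 2) → ZMod L) := by
  have hJ0 : 0 < J := zero_lt_one.trans_le hJ
  have hC : 0 < cSeq J (L₀ - 1) := cSeq_pos J _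
  have hb0 : 0 < bSeq J (L₀ - 1) := by linarith
  have hκ : 0 < kernelRatioConst (L₀ - 1) := kernelRatioConst_pos _
  have hcap : 0 < (QuantumFieldTheory.haarProbability SU2).real (polarCap (Real.sqrt J)⁻¹) :=
    lt_of_lt_of_le (by positivity) (cube_le_capMass hJ)
  have hfun : (wallEvent (L₀ := L₀) ((Finset.univ : Finset (Fin (m + 2) → ZMod L)) ×ˢ {i})).indicator
      (1 : Config (m + 2) L₀ L SU2 → ℝ) = fun U => wallFun i (polyakovLine U) :=
    funext fun U => wallEvent_indicator_eq i U
  rw [hfun]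
  have hG0 : ∀ Ω : (Fin (m + 2) → ZMod L) → SU2, 0 ≤ wallFun i Ω := fun Ω => by
    unfold wallFun; split_ifs <;> norm_num
  have ha : 0 ≤ cSeq J (L₀ - 1) ^ (m + 1 + 1) * (1 / (2 * bSeq J (L₀ - 1))) *
      (Real.exp (bSeq J (L₀ - 1)) / (2 * bSeq J (L₀ - 1))) ^ (m + 1) *
      (2 * (2 ^ (m + 1) * Real.exp (bSeq J (L₀ - 1)) + (2 * bSeq J (L₀ - 1)) ^ (2 * (m + 1)) *
        Real.exp (bSeq J (L₀ - 1) / 2))) := by positivity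
  have hβ : 0 < (QuantumFieldTheory.haarProbability SU2).real (polarCap (Real.sqrt J)⁻¹) * kernelScale (L₀ - 1) J ^ (m + 2) :=
    mul_pos hcap (pow_pos (kernelScale_pos (L₀ - 1) J) (m + 2))
  have hnum : spinIntegral L₀ J (fun Ω : (Fin (m + 2) → ZMod L) → SU2 => ENNReal.ofReal (wallFun i Ω)) ≤
      ENNReal.ofReal (cSeq J (L₀ - 1) ^ (m + 1 + 1) * (1 / (2 * bSeq J (L₀ - 1))) *
          (Real.exp (bSeq J (L₀ - 1)) / (2 * bSeq J (L₀ - 1))) ^ (m + 1) *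
        (2 * (2 ^ (m + 1) * Real.exp (bSeq J (L₀ - 1)) + (2 * bSeq J (L₀ - 1)) ^ (2 * (m + 1)) *
          Real.exp (bSeq J (L₀ - 1) / 2)))) ^ Fintype.card (Fin (m + 2) → ZMod L) := by
    have hfun2 : (fun Ω : (Fin (m + 2) → ZMod L) → SU2 => ENNReal.ofReal (wallFun i Ω)) = wallInd i :=
      funext (ofReal_wallFun i)
    rw [hfun2]
    exact spinIntegral_wall_le (m := m + 1) (L := L) (L₀ := L₀) hJ0 hb i
  rw [← ENNReal.ofReal_pow ha] at hnum
  have hden := pow_le_spinIntegral_one' (d := m + 2) (L := L) L₀ hJ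
  rw [← ENNReal.ofReal_pow hβ.le] at hden
  have key := expectation_le_div (L₀ := L₀) J _ (measurable_wallFun i) hG0 (pow_nonneg ha _) (pow_pos hβ _) hnum hden
  refine key.trans (le_of_eq ?_)
  rw [← div_pow]
  congr 1
  unfold ratioWall kernelScale
  have hE : Real.exp (bSeq J (L₀ - 1)) ≠ 0 := (Real.exp_pos _).ne'
  have hb' : bSeq J (L₀ - 1) ≠ 0 := hb0.ne'
  have hC' : cSeq J (L₀ - 1) ≠ 0 := hC.ne'
  have hκ' : kernelRatioConst (L₀ - 1) ≠ 0 := hκ.ne'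
  have hcap' : (QuantumFieldTheory.haarProbability SU2).real (polarCap (Real.sqrt J)⁻¹) ≠ 0 := hcap.ne'
  simp only [div_pow, one_div]
  field_simp
  ring

end Assembly

/-! ### §9. Decay of the per-site ratios (`≲ J^{-1/2}`) and the electric pattern bounds X'' -/

section Decay

variable {m n : ℕ}

/-- Splitting of `r₂` into the equatorial and the polar terms. [cite: TomboulisYaffe1985, §III.C (3.21)–(3.23), p. 325] -/
theorem ratioWall_eq {J : ℝ} (hJ : 16 ≤ J) :
    ratioWall m n J = 2 ^ (m + 2) / ((2 * bSeq J n) ^ (m + 2) *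
        ((QuantumFieldTheory.haarProbability SU2).real (polarCap (Real.sqrt J)⁻¹) * kernelRatioConst n ^ (m + 2))) +
      2 * (2 * bSeq J n) ^ m * Real.exp (-(bSeq J n / 2)) /
        ((QuantumFieldTheory.haarProbability SU2).real (polarCap (Real.sqrt J)⁻¹) * kernelRatioConst n ^ (m + 2)) := by
  have hb0 : 0 < bSeq J n := lt_of_lt_of_le (by positivity) (bSeq_ge J hJ n)
  have hκ : kernelRatioConst n ≠ 0 := (kernelRatioConst_pos n).ne'
  have hcap : (QuantumFieldTheory.haarProbability SU2).real (polarCap (Real.sqrt J)⁻¹) ≠ 0 :=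
    (lt_of_lt_of_le (by positivity) (cube_le_capMass (by linarith : (1 : ℝ) ≤ J))).ne'
  have hb' : bSeq J n ≠ 0 := hb0.ne'
  unfold ratioWall
  rw [show Real.exp (bSeq J n) = Real.exp (bSeq J n / 2) * Real.exp (bSeq J n / 2) by
    rw [← Real.exp_add, add_halves], Real.exp_neg]
  have hE : Real.exp (bSeq J n / 2) ≠ 0 := (Real.exp_pos _).ne'
  field_simp
  ring

/-- `e^{-x} ≤ k!/x^k` for `x > 0`. [folklore] -/
private theorem exp_neg_le_factorial_div {x : ℝ} (hx : 0 < x) (k : ℕ) : Real.exp (-x) ≤ (k.factorial : ℝ) / x ^ k := by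
  have h := Real.pow_div_factorial_le_exp x hx.le k
  rw [Real.exp_neg, inv_le_comm₀ (Real.exp_pos _) (by positivity), inv_div]
  exact h

/-- **Decay of the point-defect ratio**: `r₁(J) ≤ A₁ J^{-1/2}` for `J ≥ 16`.
[cite: TomboulisYaffe1985, §III.C (3.19), p. 324] -/
theorem ratioPoint_le {J : ℝ} (hJ : 16 ≤ J) :
    ratioPoint m n J ≤ ((4 : ℝ) ^ n) ^ 2 / (8 * (8 / (3 * Real.pi ^ 3)) * kernelRatioConst n ^ (m + 2)) * (Real.sqrt J)⁻¹ := by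
  have hJ0 : 0 < J := by linarith
  set s := Real.sqrt J with hs
  have hs0 : 0 < s := Real.sqrt_pos.mpr hJ0
  have hJs : J = s ^ 2 := (Real.sq_sqrt hJ0.le).symm
  have hκ := kernelRatioConst_pos n
  have hcap := cube_le_capMass (by linarith : (1 : ℝ) ≤ J)
  have h2b : 4 * J / 4 ^ n ≤ 2 * bSeq J n := by have := bSeq_ge J hJ n; rw [show 4 * J / 4 ^ n = 2 * (2 * J / 4 ^ n) by ring]; linarith
  have h4 : 0 < 4 * J / 4 ^ n := by positivity
  -- lower bound on the denominator
  have hD : (4 * J / 4 ^ n) ^ 2 * (8 / (3 * Real.pi ^ 3) * (s⁻¹) ^ 3 * kernelRatioConst n ^ (m + 2)) ≤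
      (2 * bSeq J n) ^ 2 * ((QuantumFieldTheory.haarProbability SU2).real (polarCap s⁻¹) * kernelRatioConst n ^ (m + 2)) :=
    mul_le_mul (pow_le_pow_left₀ h4.le h2b 2) (mul_le_mul_of_nonneg_right hcap (pow_nonneg hκ.le _)) (by positivity)
      (by positivity)
  unfold ratioPoint
  refine (div_le_div_of_nonneg_left (by norm_num) (by positivity) hD).trans (le_of_eq ?_)
  set v : ℝ := (4 : ℝ) ^ n with hv
  have hv0 : 0 < v := by positivity
  rw [hJs]
  field_simp
  ring

/-- **Decay of the wall ratio**: `r₂(J) ≤ A₂ J^{-1/2}` for `J ≥ max(16, 4^n)`.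
[cite: TomboulisYaffe1985, §III.C (3.21)–(3.24), p. 325] -/
theorem ratioWall_le {J : ℝ} (hJ : 16 ≤ J) (hJn : (4 : ℝ) ^ n ≤ J) :
    ratioWall m n J ≤ (2 ^ (m + 2) * ((4 : ℝ) ^ n) ^ 2 / (16 * (8 / (3 * Real.pi ^ 3)) * kernelRatioConst n ^ (m + 2)) +
        2 * 4 ^ m * (m + 2).factorial * ((4 : ℝ) ^ n) ^ (m + 2) / ((8 / (3 * Real.pi ^ 3)) * kernelRatioConst n ^ (m + 2))) *
      (Real.sqrt J)⁻¹ := by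
  have hJ0 : 0 < J := by linarith
  set s := Real.sqrt J with hs
  have hs0 : 0 < s := Real.sqrt_pos.mpr hJ0
  have hJs : J = s ^ 2 := (Real.sq_sqrt hJ0.le).symm
  have hκ := kernelRatioConst_pos n
  have hcap := cube_le_capMass (by linarith : (1 : ℝ) ≤ J)
  have hbge := bSeq_ge J hJ n
  have hble := bSeq_le J hJ0 n
  have hb0 : 0 < bSeq J n := lt_of_lt_of_le (by positivity) hbge
  have h2b : 4 * J / 4 ^ n ≤ 2 * bSeq J n := by rw [show 4 * J / 4 ^ n = 2 * (2 * J / 4 ^ n) by ring]; linarith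
  have h4 : 0 < 4 * J / 4 ^ n := by positivity
  have h41 : 1 ≤ 4 * J / 4 ^ n := by rw [le_div_iff₀ (by positivity)]; linarith
  rw [ratioWall_eq hJ, add_mul]
  refine add_le_add ?_ ?_
  · -- equatorial term
    have hD : (4 * J / 4 ^ n) ^ 2 * (8 / (3 * Real.pi ^ 3) * (s⁻¹) ^ 3 * kernelRatioConst n ^ (m + 2)) ≤
        (2 * bSeq J n) ^ (m + 2) * ((QuantumFieldTheory.haarProbability SU2).real (polarCap s⁻¹) * kernelRatioConst n ^ (m + 2)) :=
      mul_le_mul ((pow_le_pow_right₀ h41 (by omega : 2 ≤ m + 2)).trans (pow_le_pow_left₀ h4.le h2b _))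
        (mul_le_mul_of_nonneg_right hcap (pow_nonneg hκ.le _)) (by positivity) (by positivity)
    refine (div_le_div_of_nonneg_left (by positivity) (by positivity) hD).trans (le_of_eq ?_)
    set v : ℝ := (4 : ℝ) ^ n with hv
    have hv0 : 0 < v := by positivity
    rw [hJs]
    field_simp
    ring
  · -- polar term
    have hnum : 2 * (2 * bSeq J n) ^ m * Real.exp (-(bSeq J n / 2)) ≤
        2 * (4 * J) ^ m * ((m + 2).factorial / (J / 4 ^ n) ^ (m + 2)) := by
      refine mul_le_mul (mul_le_mul_of_nonneg_left (pow_le_pow_left₀ (by positivity) (by linarith) m) (by norm_num))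
        ?_ (Real.exp_pos _).le (by positivity)
      refine (Real.exp_le_exp.mpr ?_).trans (exp_neg_le_factorial_div (by positivity : 0 < J / 4 ^ n) (m + 2))
      have : J / 4 ^ n ≤ bSeq J n / 2 := by rw [div_le_iff₀ (by positivity)] at *; linarith
      linarith
    have hD : 8 / (3 * Real.pi ^ 3) * (s⁻¹) ^ 3 * kernelRatioConst n ^ (m + 2) ≤
        (QuantumFieldTheory.haarProbability SU2).real (polarCap s⁻¹) * kernelRatioConst n ^ (m + 2) :=
      mul_le_mul_of_nonneg_right hcap (pow_nonneg hκ.le _)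
    refine (div_le_div₀ (by positivity) hnum (by positivity) hD).trans (le_of_eq ?_)
    set v : ℝ := (4 : ℝ) ^ n with hv
    have hv0 : 0 < v := by positivity
    rw [hJs]
    simp only [div_pow]
    field_simp
    ring

end Decay

/-! ### §10. THE ELECTRIC PATTERN BOUNDS X'' and Theorems I, II of Tomboulis–Yaffe -/

section Main

/-- **THE ELECTRIC PATTERN BOUNDS (X'')** — the hypothesis of the tree's `disorderBounds_of_electricPatternBounds`:
at zero space-like coupling, for `d ≥ 2`, `L₀ = 2^a` and `J > J₀(d, a)`, the point-defect pattern and the axis wall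
patterns have per-site cost `K(J) → 0` (`K ≍ J^{-1/2d}`). This is the content of TY §III.C, eqs. (3.9)–(3.24), in the
electric sector. [cite: TomboulisYaffe1985, §III.C (3.9)–(3.24), pp. 323–325] -/
theorem electricPatternBounds :
    ∀ d : ℕ, 2 ≤ d → ∀ a : ℕ, ∃ J₀ : ℝ, ∃ K : ℝ → ℝ, Tendsto K atTop (𝓝 0) ∧
      ∀ J : ℝ, J₀ < J → ∀ k : ℕ, 2 ≤ k →
        expectation (d := d) (L₀ := 2 ^ a) (L := 2 ^ k) (fundamentalRep (Fin 2)) J 0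
            (fun U => ∏ x, (1 - |halfTrace U x|)) ≤ K J ^ (2 ^ k) ^ d ∧
        ∀ i : Fin d, expectation (d := d) (L₀ := 2 ^ a) (L := 2 ^ k) (fundamentalRep (Fin 2)) J 0
            ((wallEvent ((Finset.univ : Finset (Fin d → ZMod (2 ^ k))) ×ˢ {i})).indicator 1) ≤
          K J ^ (d * (2 ^ k) ^ d) := by
  intro d hd a
  obtain ⟨m, rfl⟩ : ∃ m, d = m + 2 := ⟨d - 2, by omega⟩
  set n : ℕ := 2 ^ a - 1 with hn
  -- the decay constants
  set A₁ : ℝ := ((4 : ℝ) ^ n) ^ 2 / (8 * (8 / (3 * Real.pi ^ 3)) * kernelRatioConst n ^ (m + 2)) with hA₁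
  set A₂ : ℝ := 2 ^ (m + 2) * ((4 : ℝ) ^ n) ^ 2 / (16 * (8 / (3 * Real.pi ^ 3)) * kernelRatioConst n ^ (m + 2)) +
    2 * 4 ^ m * (m + 2).factorial * ((4 : ℝ) ^ n) ^ (m + 2) / ((8 / (3 * Real.pi ^ 3)) * kernelRatioConst n ^ (m + 2)) with hA₂
  have hκ := kernelRatioConst_pos n
  have hA₁0 : 0 ≤ A₁ := by rw [hA₁]; positivity
  have hA₂0 : 0 ≤ A₂ := by rw [hA₂]; positivity
  have hd0 : (m + 2 : ℕ) ≠ 0 := by omega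
  have hdinv : 0 < ((m + 2 : ℕ) : ℝ)⁻¹ := by positivity
  refine ⟨max 16 ((4 : ℝ) ^ n), fun J => max (ratioPoint m n J) (ratioWall m n J ^ ((m + 2 : ℕ) : ℝ)⁻¹), ?_, ?_⟩
  · -- `K(J) → 0`: squeeze between `0` and `max(A₁ J^{-1/2}, (A₂ J^{-1/2})^{1/d})`
    have hsq : Tendsto (fun J : ℝ => (Real.sqrt J)⁻¹) atTop (𝓝 0) :=
      tendsto_inv_atTop_zero.comp Real.tendsto_sqrt_atTop
    have hg : Tendsto (fun J : ℝ => max (A₁ * (Real.sqrt J)⁻¹) ((A₂ * (Real.sqrt J)⁻¹) ^ ((m + 2 : ℕ) : ℝ)⁻¹)) atTop (𝓝 0) := by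
      have h1 : Tendsto (fun J : ℝ => A₁ * (Real.sqrt J)⁻¹) atTop (𝓝 0) := by
        simpa using hsq.const_mul A₁
      have h2 : Tendsto (fun J : ℝ => (A₂ * (Real.sqrt J)⁻¹) ^ ((m + 2 : ℕ) : ℝ)⁻¹) atTop (𝓝 0) := by
        have h2' : Tendsto (fun J : ℝ => A₂ * (Real.sqrt J)⁻¹) atTop (𝓝 0) := by simpa using hsq.const_mul A₂
        have hc : Tendsto (fun x : ℝ => x ^ ((m + 2 : ℕ) : ℝ)⁻¹) (𝓝 0) (𝓝 0) := by
          have h := (Real.continuous_rpow_const hdinv.le).tendsto 0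
          rwa [Real.zero_rpow hdinv.ne'] at h
        exact hc.comp h2'
      simpa using h1.max h2
    refine tendsto_of_tendsto_of_tendsto_of_le_of_le' tendsto_const_nhds hg ?_ ?_
    · exact Eventually.of_forall fun J => le_max_of_le_left (ratioPoint_nonneg m n J)
    · filter_upwards [eventually_ge_atTop (max 16 ((4 : ℝ) ^ n))] with J hJ
      have hJ16 : 16 ≤ J := le_trans (le_max_left _ _) hJ
      have hJn : (4 : ℝ) ^ n ≤ J := le_trans (le_max_right _ _) hJ
      exact max_le_max (ratioPoint_le hJ16)
        (Real.rpow_le_rpow (ratioWall_nonneg m n (by linarith)) (ratioWall_le hJ16 hJn) hdinv.le)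
  · intro J hJ k hk
    have hJ16 : 16 ≤ J := le_trans (le_max_left _ _) hJ.le
    have hJn : (4 : ℝ) ^ n ≤ J := le_trans (le_max_right _ _) hJ.le
    have hJ1 : (1 : ℝ) ≤ J := by linarith
    have hb : 1 / 2 ≤ bSeq J (2 ^ a - 1) := by
      have h1 := bSeq_ge J hJ16 n
      have h2 : (2 : ℝ) ≤ 2 * J / 4 ^ n := by rw [le_div_iff₀ (by positivity)]; linarith
      rw [← hn]; linarith
    have hcard : Fintype.card (Fin (m + 2) → ZMod (2 ^ k)) = (2 ^ k) ^ (m + 2) := by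
      rw [Fintype.card_fun, ZMod.card, Fintype.card_fin]
    refine ⟨?_, fun i => ?_⟩
    · calc expectation (d := m + 2) (L₀ := 2 ^ a) (L := 2 ^ k) (fundamentalRep (Fin 2)) J 0
            (fun U => ∏ x, (1 - |halfTrace U x|))
          ≤ ratioPoint m (2 ^ a - 1) J ^ Fintype.card (Fin (m + 2) → ZMod (2 ^ k)) := expectation_pointDefect_le hJ1 hb
        _ ≤ (max (ratioPoint m n J) (ratioWall m n J ^ ((m + 2 : ℕ) : ℝ)⁻¹)) ^ (2 ^ k) ^ (m + 2) := by
            rw [hcard]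
            exact pow_le_pow_left₀ (ratioPoint_nonneg m n J) (le_max_left _ _) _
    · calc expectation (d := m + 2) (L₀ := 2 ^ a) (L := 2 ^ k) (fundamentalRep (Fin 2)) J 0
            ((wallEvent ((Finset.univ : Finset (Fin (m + 2) → ZMod (2 ^ k))) ×ˢ {i})).indicator 1)
          ≤ ratioWall m (2 ^ a - 1) J ^ Fintype.card (Fin (m + 2) → ZMod (2 ^ k)) := expectation_axisWall_le hJ1 hb i
        _ = ((ratioWall m n J ^ ((m + 2 : ℕ) : ℝ)⁻¹) ^ (m + 2)) ^ (2 ^ k) ^ (m + 2) := by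
            rw [hcard, Real.rpow_inv_natCast_pow (ratioWall_nonneg m n (by linarith)) hd0]
        _ ≤ ((max (ratioPoint m n J) (ratioWall m n J ^ ((m + 2 : ℕ) : ℝ)⁻¹)) ^ (m + 2)) ^ (2 ^ k) ^ (m + 2) :=
            pow_le_pow_left₀ (pow_nonneg (Real.rpow_nonneg (ratioWall_nonneg m n (by linarith)) _) _)
              (pow_le_pow_left₀ (Real.rpow_nonneg (ratioWall_nonneg m n (by linarith)) _) (le_max_right _ _) _) _
        _ = (max (ratioPoint m n J) (ratioWall m n J ^ ((m + 2 : ℕ) : ℝ)⁻¹)) ^ ((m + 2) * (2 ^ k) ^ (m + 2)) := by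
            rw [← pow_mul]

end Main

end

end Literature.MathematicalPhysics.QuantumFieldTheory.TomboulisYaffeHighTemperature
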